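import Mathlib.Algebra.CharP.Defs
import Mathlib.LinearAlgebra.Matrix.SchurComplement
import Mathlib.LinearAlgebra.Matrix.Rank
import Literature.Computability.AlgebraicComplexity.HessianRank
import Literature.Computability.AlgebraicComplexity.PermanentMonotone
import Literature.Computability.AlgebraicComplexity.DeterminantalComplexityProofs
import Literature.Computability.AlgebraicComplexity.StandardFamilies
import Literature.Computability.AlgebraicComplexity.MignonRessayreCharZero
import HarnessLib

/-!
# Cai–Chen–Li 2010: Hessian-rank points of the permanent in odd characteristic

Typed literature (val-lit cell, seat t17, row `CCL2010-A`): J.-Y. Cai, X. Chen, D. Li, *Quadratic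
lower bound for permanent vs. determinant in any characteristic*, comput. complex. 19 (2010)
37–56, doi:10.1007/s00037-009-0284-2 (conference version STOC 2008). Honest framing: bookkeeping
of a published result; `VP ≠ VNP` is NOT proved and nothing here is progress on it.

## Source status: HELD (v2 of this file)

v1 of this file was typed from secondary loci while the text was un-held (acq-00165 / acq-01062,
cite-only). v2 is reconciled against the PRIMARY text: the authors' copy of the publisher's
typeset (PDF metadata `CC-9-284.dvi`, running heads «cc 19 (2010)», p. 1 = journal p. 37), staged
by the cell's literature seat with per-page text `p001–p020` (printed page = PDF page + 36; the
locators below read «p. ‹printed› (PDF pNNN:Lnn)»). Outcome of the reconciliation: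
* conjunct (ii) of the named fact `caiChenLi2010_thm_2_3` SHARPENED to its printed
  `(n+1) × (n+1)` form (v1 carried the weaker placeholder «a zero of `per_{n+2}`», announced by
  its own `TODO`); the in-file consequences gain one index accordingly;
* hypotheses of Thm. 2.3 confirmed complete as typed (`p > 2`; (i) `p ≠ 23`, `n > 2`, `p ∣ n+1`;
  (ii) `p ∉ {3,5}`, `n > 1`, `p ∣ n+2`);
* the Cor. 2.4 index caveat of v1 confirmed against the printed proof (see below);
* Thm. 1.5 (Marcus–Minc, as quoted, with its `dc` form) and Lemma 2.7 added as PROVED theorems.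

## Concordance (printed statement → tree)

| printed | p. (PDF) | here / in tree | status |
|---|---|---|---|
| Thm 1.1, 1.2 (Valiant: `per ∈ VNP`, VNP-complete for char ≠ 2; universality of `det`) | 38 (p002:L25, L31) | background; universality in tree as `exists_hasDetRepr_holds` | cited, not restated |
| Thm 1.3 (`per_n = det_m(A)` with `m = O(2ⁿ)`) | 39 (p003:L2–L8) | tree: `HuttenhainIkenmeyer.determinantalComplexity_perPoly_le_two_pow_sub_one` (`dc(per_n) ≤ 2ⁿ − 1`, any commutative ring; `BinaryDeterminantalComplexityProofs.lean`) | cited, not restated |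
| Def 1.4 (`dc`) | 39 (p003:L10–L12) | tree: `determinantalComplexity` (attained `sInf`) | cited |
| Thm 1.5 (Marcus–Minc 1961) + «equivalent to `dc(per_n) ≥ n+1`» | 39 (p003:L31–L37) | `caiChenLi2010_thm_1_5`, `caiChenLi2010_thm_1_5_dc` | PROVED (from the tree's Mignon–Ressayre bound) |
| §2.1 (chain rule: `rank H(X₀) ≤ 2·dc` at a zero `X₀`) | 41–42 (p005:L7–p006:L44) | tree: `rank_hessianMatrix_le_two_mul_determinantalComplexity` (any field, `HessianRank.lean`) | cited |
| Thm 2.2 (Mignon–Ressayre: char 0, `dc(per_n) ≥ n²/2`) | 42 (p006:L45–L46) | tree: `sq_le_two_mul_determinantalComplexity_perPoly_charZero_holds` | cited (PROVED in tree) |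
| **Thm 2.3** | 43 (p007:L16–L32) | `caiChenLi2010_thm_2_3` (named `def … : Prop`) — **DISCHARGED**: `caiChenLi2010_thm_2_3_holds` | PROVED (by a different route, see `rank_hessianMatrix_perPoly_caiChenLiMatrix`: no exceptional primes needed) |
| remark «a lower bound for `𝔽_p` is also valid over `ℚ`» | 43 (p007:L33–L34) | not typed (authors' remark, no statement number) | — |
| **Cor 2.4** | 43 (p007:L35–L36) | `caiChenLi2010_cor_2_4` (+ `caiChenLi2010_dc_of_thm_2_3`, `caiChenLi2010_eventually`) | PROVED from the fact |
| the witness `Mⁿ_v`; «`per(M) = n+1`» / `n ≡ −v` | 43 (p007:L37–p008:L1); 45 (p009:L48), 48 (p012:L32–L33) | `caiChenLiMatrix` (def), `eval_caiChenLiMatrix_perPoly` (`per(Mⁿ_v) = n + v`), `eval_caiChenLiMatrix_perPoly_eq_zero` | PROVED |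
| **Lemma 2.5** (entries of `H(Mⁿ_v)` on `S × S`, `S = {(i,j) : i ≠ j ≤ n}`) | 44 (p008:L9–L17) | `caiChenLi2010_lemma_2_5` (+ the case lemmas `…_transpose`, `…_case2`, `…_case3`, `…_zero_a/b/c` and the support counts `sum_perm_fix_prod_caiChenLiMatrix`, `sum_perm_fix_pin_prod_caiChenLiMatrix`, `sum_perm_fix_mul_prod_caiChenLiMatrix`) | PROVED (any field) |
| Lemma 2.6 (inner products `H_{ij}·H_{kl}` of the truncated rows) | 44 (p008:L25–L30) | NOT typed: finite counting over `(k,l) ∈ S` from Lemma 2.5 | — |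
| Lemma 2.7 (`det` of the matrix with `α` on the diagonal and `β` elsewhere) | 45 (p009:L4–L10) | `caiChenLi2010_lemma_2_7` | PROVED (any field) |
| Lemma 3.1 («weaker theorem»: `p ∣ n+1`, `n` large ⇒ `per(Mⁿ_1) ≡ 0` and `rank H(Mⁿ_1) = Ω(n²)`) | 45 (p009:L44–L46) | `caiChenLi2010_lemma_3_1` (both assertions; `Ω(n²)` explicit as `n² ≤ 2·rank H(Mⁿ_1)` for `n ≥ 7`) | PROVED |
| Lemma 4.1, 4.2 (blocks of `R_v R_vᵀ`) | 49, 52 (p013:L39, p016:L34) | NOT typed: proof-internal, and BYPASSED by the kernel argument of `rank_hessianMatrix_perPoly_caiChenLiMatrix` | — |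

FAITHFULNESS NOTES.
* Thm. 2.3 is printed over `𝔽_p`; it is typed over every field `F` of characteristic `p` — implied
  by the printed form (an `𝔽_p`-point is an `F`-point, and the rank of a matrix with entries in the
  prime field does not change under field extension).
* Cor. 2.4 as printed: «there exist infinitely many positive integers `n` such that
  `dc(per_n) ≥ (n−2)(n−3)/2`». What the printed proof gives (Thm. 2.3, whose witnesses `Mⁿ_v` are
  `(n+1) × (n+1)` matrices, + the §2.1 chain rule) is `(n−2)(n−3) ≤ 2·dc(per_{n+1})` for
  infinitely many `n`, i.e. `(m−3)(m−4)/2 ≤ dc(per_m)` for infinitely many `m` — one index short of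
  the printed wording. `caiChenLi2010_cor_2_4` states the form the proof gives (no second fact); the
  quadratic content for ALL large `n` is `caiChenLi2010_eventually`.
* A. Yabe (arXiv:1504.00151, §1) and arXiv:2202.13016 §1 quote the result correctly as a quadratic
  bound in characteristic `≠ 2`; M. Mahajan, *Algebraic complexity classes* (arXiv:1307.3863, p. 10)
  quotes it as «the same lower bound [`n²/2`] … for fields of characteristic other than 2», an
  over-statement relative to the printed `(n−2)(n−3)/2` — recorded so that nobody re-types `n²/2` for
  odd `p` (the tree's `sq_le_two_mul_determinantalComplexity_perPoly` was once mis-cited this way and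
  has been restated to characteristic `0`; see `PermanentVsDeterminant.lean`, "Verdict clean-up").

## Contents

* `caiChenLi2010_thm_1_5_dc`, `caiChenLi2010_thm_1_5` — PROVED: Marcus–Minc in the two printed
  forms (char `0`, `n ≥ 3`: `dc(per_n) ≥ n + 1`; no `n × n` matrix of linear forms with
  `det = per_n`), from the tree's Mignon–Ressayre bound.
* `caiChenLi2010_thm_2_3` — FACT (named `def … : Prop`): the Hessian-rank points, cases (i)/(ii),
  as printed.
* `caiChenLi2010_lemma_2_7` — PROVED: `det (α on the diagonal, β elsewhere) = (α+(n−1)β)(α−β)^{n−1}`.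
* `caiChenLiMatrix` (DEFINITION, the printed witness `Mⁿ_v`) with `eval_caiChenLiMatrix_perPoly`
  (PROVED: `per(Mⁿ_v) = n + v`, the identity and the `n` transpositions `(j, n+1)` being the only
  permutations supported on its pattern) and `eval_caiChenLiMatrix_perPoly_eq_zero` (PROVED: hence
  `per(Mⁿ_v) = 0` in characteristic `p ∣ n + v` — the «`per(X₀) ≡ 0`» half of the witness claim of
  Thm. 2.3 and the first assertion of Lemma 3.1; the Hessian-rank half is the open content of the fact).
* `caiChenLi2010_lemma_2_5` — PROVED: the printed four-case formula for the Hessian entries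
  `H_{ij,kl}(Mⁿ_v)`, `i ≠ j`, `k ≠ l` non-last (`v+n−2` / `1` / `1` / `0`), from the sub-permanent
  formula `hess0_transl_perPoly` (`MignonRessayreBound.lean`) and three support counts for the
  pattern of `Mⁿ_v` (identity / transpositions `(t₀, n+1)` / one pinned index). This is the input of
  the paper's §4 (`R_v = H|_{S×S}`); what remains of `caiChenLi2010_thm_2_3` is the rank estimate
  `rank(R_v R_vᵀ) ≥ (n−2)(n−3)` (Lemmas 2.6, 4.1, 4.2 with Lemma 2.7).
* `rank_hessianMatrix_perPoly_caiChenLiMatrix` — PROVED: in characteristic `p ∣ n + v`, `p` odd,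
  `n² − n ≤ rank H(Mⁿ_v) + 2(n+1)`. NOT the printed §4 argument: with `P` the index transposition
  on `S`, Lemma 2.5 reads `R·P = (v+n−2)·1 + A` where `A = BᵀB − 2·1` is the adjacency matrix of the
  line graph of the pairs in `S` (`B` = vertex–pair incidence matrix); since `v + n ≡ 0`,
  `R·P ≡ BᵀB − 4·1`, which acts as `−4 ≠ 0` on `ker B` (dimension `≥ |S| − 2(n+1)`), and
  `rank H ≥ rank R`. This needs NO exceptional primes (the printed route excludes `p = 23`, resp.
  `p ∈ {3,5}`, because it computes determinants of the blocks of `R Rᵀ`, Lemmas 4.1/4.2/2.7).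
* `caiChenLi2010_thm_2_3_holds` — **DISCHARGE of the named fact** `caiChenLi2010_thm_2_3`
  (witness `Mⁿ_v`, `per = 0` by `eval_caiChenLiMatrix_perPoly_eq_zero`, rank by the previous item;
  `(n−2)(n−3) ≤ n² − 3n − 2` for `n ≥ 4`, `= 0` for `n ≤ 3`). Consequently `caiChenLi2010_cor_2_4`,
  `caiChenLi2010_dc_of_thm_2_3`, `caiChenLi2010_eventually` hold unconditionally (feed `_holds`).
* `caiChenLi2010_lemma_3_1` (PROVED, `Ω(n²)` explicit as `n² ≤ 2·rank` for `n ≥ 7`),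
  `caiChenLi2010_dc_bound`, `caiChenLi2010_cor_2_4_uncond`, `caiChenLi2010_quadratic_lower_bound` —
  the unconditional forms.
* BS26-A part B (cell blueprint `lmr/BLUEPRINT-OddCharHessianBound.md` §2/§7, lead-lmr ruling
  2026-08-26T07:22:44Z): the Hessian entries of `per_{n+1}` at `Mⁿ_v` for off-diagonal pairs THROUGH
  the last index `★` — PROVED: `hessianMatrix_caiChenLiMatrix_lastA_aLast`, `…_aLast_lastA`,
  `…_lastA_aB`, `…_aB_lastA`, `…_aLast_bA`, `…_aB_bLast` (value `1`, any `v`) and the vanishing ones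
  `…_lastA_bC`, `…_aLast_bC`, `…_aB_lastC`, `…_aB_cLast`, `…_lastA_bLast`, `…_aLast_lastB`; all
  assembled with Lemma 2.5 into ONE closed form `hessianMatrix_perPoly_caiChenLiMatrix_offDiag`
  (for `i ≠ j`, `k ≠ l`: `v+n−2` on inner transposed pairs, `1` on transposed pairs through `★` and
  on «continuing» pairs `k = j ≠ ★, l ≠ i` / `l = i ≠ ★, k ≠ j`, else `0`) — the interface for the
  cell's `bsR` (at `v = −n`). Same sub-permanent technique (`hess0_transl_perPoly` + cycle
  reindexing + the support count `sum_perm_fix_last_prod_caiChenLiMatrix`: only the identity fixes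
  `★` and is supported off a set with ≤ 1 free index).
* `rank_hessianMatrix_perPoly_caiChenLiMatrix_neg`, `sq_le_two_mul_determinantalComplexity_perPoly_add_of_two_ne_zero`
  — PROVED over EVERY field with `2 ≠ 0` (corner `v = −n` taken in the field, no characteristic
  hypothesis): `n² − n ≤ rank H(Mⁿ_{−n}) + 2(n+1)` and `m² ≤ 2·dc(per_m) + 5m` for all `m` — the
  interim, inverse-free form of the cell's BS26-A target `m² − m ≤ 2·dc(per_m)` (Bedi–Suagee).
  Rank-level shapes: `sq_sub_le_two_mul_determinantalComplexity_perPoly_add_of_two_ne_zero`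
  (`n² − n ≤ 2·dc(per_{n+1}) + 2(n+1)`, any field with `2 ≠ 0`) and
  `caiChenLi2010_quadratic_lower_bound_uniform` (the same in every odd characteristic `p`).
* `determinantalComplexity_perPoly_mono` — PROVED: `dc(per_m) ≤ dc(per_{m'})` for `m ≤ m'` (the
  tree's `isProjection_perPoly_of_le` + `determinantalComplexity_le_of_isProjection_holds`;
  Bürgisser 2000, §2.5).
* `caiChenLi2010_dc_of_thm_2_3` — PROVED from the fact via the tree's Mignon–Ressayre rank bound
  `rank_hessianMatrix_le_two_mul_determinantalComplexity` (any field): in both cases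
  `(n−2)(n−3) ≤ 2·dc(per_{n+1})`.
* `caiChenLi2010_cor_2_4` — PROVED from the fact: for every odd prime `p` and field of
  characteristic `p`, infinitely many `n` with `(n−2)(n−3) ≤ 2·dc(per_{n+1})` (the index the
  printed proof gives).
* `caiChenLi2010_eventually` — PROVED from the fact + monotonicity: for every field of odd
  characteristic `p` and every `n ≥ p + 3`, `(n−p−2)(n−p−3) ≤ 2·dc(per_n)`, i.e.
  `dc(per_n) ≥ (½ − o(1))·n²` for each fixed odd `p` — the precise content of the paper's title
  claim "quadratic lower bound … in any characteristic".

Vocabulary (cited, not re-declared): `perPoly`, `determinantalComplexity`, `HasDetRepr`,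
`hessianMatrix` (`HessianRank.lean`), `CharP`. Characteristic `2` (where `per = det`) is
`Literature.Barriers.ValiantsHypothesis.CharacteristicTwo`.

## References

* [CaiChenLi2010] J.-Y. Cai, X. Chen, D. Li, *Quadratic lower bound for permanent vs. determinant
  in any characteristic*, comput. complex. 19 (2010) 37–56, doi:10.1007/s00037-009-0284-2 — HELD
  (authors' copy of the publisher's typeset; acq-00165 resolved by the cell's literature seat,
  shared-store ingestion acq-11257): Thm. 1.5 p. 39, §2.1 pp. 41–42, Thm. 2.2 p. 42, Thm. 2.3 /
  Cor. 2.4 p. 43, Lemma 2.7 p. 45, proof of Thm. 2.3 §4 pp. 48–53. STOC 2008 version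
  (doi:10.1145/1374376.1374446, acq-01062) not held and not needed.
* [MignonRessayre2004] T. Mignon, N. Ressayre, IMRN 2004:79, 4241–4253.
* [MarcusMinc1961] M. Marcus, H. Minc, *On the relation between the determinant and the
  permanent*, Illinois J. Math. 5 (1961) 376–381 (as quoted in [CaiChenLi2010], Thm. 1.5).
* [Burgisser2000] P. Bürgisser, *Completeness and Reduction in Algebraic Complexity Theory*, §2.5.
-/

noncomputable section

open MvPolynomial Matrix

namespace Literature.Computability.AlgebraicComplexity

universe u

/-! ### Theorem 1.5 (Marcus–Minc, as quoted) — proved from the tree's Mignon–Ressayre bound -/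

/-- **Cai–Chen–Li 2010, Thm. 1.5, `dc` form** (p. 39, PDF p003:L35–L37: «In terms of `dc(per_n)`,
this celebrated theorem is equivalent to `dc(per_n) ≥ n+1`, over any field of `char F = 0`»): for
a field `F` of characteristic `0` and `n ≥ 3`, `n + 1 ≤ dc(per_n)`. PROVED — not by the 1961
argument but from the (later, stronger) Mignon–Ressayre bound `n² ≤ 2·dc(per_n)` in tree
(`sq_le_two_mul_determinantalComplexity_perPoly_charZero_holds`, their Thm. 2.2): `2(n+1) ≤ n²`
for `n ≥ 3`. [cite: CaiChenLi2010, Thm. 1.5 (dc form), p. 39] -/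
theorem caiChenLi2010_thm_1_5_dc (F : Type u) [Field F] [CharZero F] {n : ℕ} (hn : 3 ≤ n) :
    n + 1 ≤ determinantalComplexity (perPoly (Fin n) F) := by
  have hsq := sq_le_two_mul_determinantalComplexity_perPoly_charZero_holds F n
  by_contra hlt
  rw [not_le] at hlt
  have h2n : n ^ 2 ≤ 2 * n := hsq.trans (by omega)
  nlinarith

/-- **Cai–Chen–Li 2010, Thm. 1.5 (Marcus & Minc 1961), as printed** (p. 39, PDF p003:L31–L34):
«If `char F = 0` and `n ≥ 3`, then there are no homogeneous linear functions `f_{k,ℓ}` in the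
indeterminates `x_{i,j}`, `1 ≤ i,j,k,ℓ ≤ n`, such that `per_n(x_{i,j}) = det_n(f_{k,ℓ})`.» Typed with
«homogeneous linear» = `MvPolynomial.IsHomogeneous · 1` (the zero form allowed), exactly as the
tree's `Bur24_marcusMinc_complex` (the case `F = ℂ`). PROVED from `caiChenLi2010_thm_1_5_dc`: such
a matrix is an affine determinantal representation of size `n` (`HasDetRepr`), whence
`dc(per_n) ≤ n`. [cite: CaiChenLi2010, Thm. 1.5, p. 39] [cite: MarcusMinc1961, Thm. (as quoted)] -/
theorem caiChenLi2010_thm_1_5 (F : Type u) [Field F] [CharZero F] {n : ℕ} (hn : 3 ≤ n) :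
    ¬ ∃ f : Matrix (Fin n) (Fin n) (MvPolynomial (Fin n × Fin n) F),
      (∀ k l, (f k l).IsHomogeneous 1) ∧ f.det = perPoly (Fin n) F := by
  rintro ⟨f, hlin, hdet⟩
  have hrepr : HasDetRepr (perPoly (Fin n) F) n :=
    ⟨f, fun k l => (hlin k l).totalDegree_le, hdet⟩
  have hdc := determinantalComplexity_le_of_hasDetRepr hrepr
  have hn1 := caiChenLi2010_thm_1_5_dc F hn
  omega

/-! ### Theorem 2.3 (named fact) -/

/-- **Cai–Chen–Li 2010, Theorem 2.3** (p. 43, PDF p007:L16–L32), verbatim: «Let `p > 2` be a prime,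
then (i) If `p ≠ 23`, then for every `n > 2` that satisfies `p ∣ (n+1)`, there exists an
`(n+1) × (n+1)` matrix `X₀` over finite field `𝔽_p` such that `per(X₀) ≡ 0 (mod p)` and
`rank(H(X₀)) ≥ (n−2)(n−3)`; (ii) If `p ≠ 3, 5`, then for every `n > 1` that satisfies
`p ∣ (n+2)`, there exists an `(n+1) × (n+1)` matrix `X₀` over finite field `𝔽_p` such that
`per(X₀) ≡ 0 (mod p)` and `rank(H(X₀)) ≥ (n−2)(n−3)`.» Here `H(X₀)` is the `(n+1)² × (n+1)²`
Hessian of `per_{n+1}` at `X₀` (their §2.1, p. 41), in tree `hessianMatrix (perPoly (Fin (n+1)) F) X₀`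
(`HessianRank.lean`), and `rank` = `Matrix.rank` over `F`. TYPING NOTES: (a) printed over `𝔽_p`,
typed over every field `F` of characteristic `p` (implied: an `𝔽_p`-point is an `F`-point and the
rank of a prime-field matrix is unchanged by field extension); (b) `(n−2)(n−3)` has no
`ℕ`-truncation issue (`n ≥ 2` in both cases; value `0` at `n = 2`); (c) the printed witness is the
explicit matrix `X₀ = Mⁿ_v` (below: `caiChenLiMatrix`, with `per(Mⁿ_v) = n + v` PROVED; p. 43, PDF p007:L37–p008:L1: `M_{n+1,n+1} = v`,
`M_{i,i} = M_{n+1,i} = M_{i,n+1} = 1` for `i ≤ n`, `0` otherwise; `v = 1` in case (i), `v = 2` in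
case (ii), so that `per(Mⁿ_v) = n + v ≡ 0`, §4 p. 48, PDF p012:L32–L33), and the exclusions
`p ≠ 23`, resp. `p ∉ {3,5}`, come from the residues `(−46)(−16)^{n−3}`, resp. `(−60)(−16)^{n−3}`
(p. 53, PDF p017:L44–L47); the theorem is typed in its printed `∃` form. (v1 of this file typed (ii)
with the weaker placeholder «a zero of `per_{n+2}`»; this is the printed form.) PROVED in tree (`caiChenLi2010_thm_2_3_holds`, below, by a shorter route than the printed one);
the printed proof is ≈ 6 pages of explicit linear algebra over `𝔽_p` (Lemmas 2.5–2.7, 4.1, 4.2; Lemmas 2.5 and 2.7 and `per(Mⁿ_v) = n + v` are PROVED below, the rank estimate of §4 is not).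
[cite: CaiChenLi2010, Thm. 2.3, p. 43] -/
def caiChenLi2010_thm_2_3 : Prop :=
  ∀ (p : ℕ) [Fact p.Prime] (F : Type u) [Field F] [CharP F p], p ≠ 2 →
    (p ≠ 23 → ∀ n : ℕ, 2 < n → p ∣ n + 1 →
      ∃ X₀ : Fin (n + 1) × Fin (n + 1) → F, eval X₀ (perPoly (Fin (n + 1)) F) = 0 ∧
        (n - 2) * (n - 3) ≤ (hessianMatrix (perPoly (Fin (n + 1)) F) X₀).rank) ∧
    (p ≠ 3 → p ≠ 5 → ∀ n : ℕ, 1 < n → p ∣ n + 2 →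
      ∃ X₀ : Fin (n + 1) × Fin (n + 1) → F, eval X₀ (perPoly (Fin (n + 1)) F) = 0 ∧
        (n - 2) * (n - 3) ≤ (hessianMatrix (perPoly (Fin (n + 1)) F) X₀).rank)

/-! ### Lemma 2.7 (proved) -/

/-- **Cai–Chen–Li 2010, Lemma 2.7** (p. 45, PDF p009:L4–L10): «Let `A = (A_{i,j})_{i,j=1,…,n}` be an
`n × n` matrix over `𝔽_p`, which satisfies `A_{i,i} = α` for all `1 ≤ i ≤ n` and `A_{i,j} = β`
otherwise. Then we have `det(A) = (α+(n−1)β)(α−β)^{n−1}`.» PROVED over every field (printed: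
`𝔽_p`), for `n ≥ 1` (implicit in print). In place of the printed row reduction: for `α ≠ β`,
`A = (α−β)·(1 + u·vᵀ)` with `u ≡ β/(α−β)`, `v ≡ 1` and the rank-one determinant lemma
`det(1 + u vᵀ) = 1 + v·u` (Mathlib `det_one_add_replicateCol_mul_replicateRow`); for `α = β`, two
equal rows. [cite: CaiChenLi2010, Lemma 2.7, p. 45] -/
theorem caiChenLi2010_lemma_2_7 (F : Type u) [Field F] {n : ℕ} (hn : 1 ≤ n) (α β : F) :
    (Matrix.of fun i j : Fin n => if i = j then α else β).det =
      (α + ((n - 1 : ℕ) : F) * β) * (α - β) ^ (n - 1) := by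
  by_cases hαβ : α = β
  · subst hαβ
    rcases Nat.lt_or_ge n 2 with hlt | hge
    · interval_cases n
      simp [Matrix.det_unique]
    · -- two equal rows
      obtain ⟨m, rfl⟩ : ∃ m, n = m + 2 := ⟨n - 2, by omega⟩
      have hdet : (Matrix.of fun i j : Fin (m + 2) => if i = j then α else α).det = 0 :=
        Matrix.det_zero_of_row_eq (i := 0) (j := 1) (by simp) (by ext j; simp)
      rw [hdet]
      simp
  · obtain ⟨m, rfl⟩ : ∃ m, n = m + 1 := ⟨n - 1, by omega⟩
    rw [Nat.add_sub_cancel]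
    have hne : α - β ≠ 0 := sub_ne_zero.mpr hαβ
    have hA : (Matrix.of fun i j : Fin (m + 1) => if i = j then α else β) =
        (α - β) • (1 + vecMulVec (fun _ => β / (α - β)) (fun _ => (1 : F))) := by
      ext i j
      by_cases h : i = j
      · subst h
        simp only [Matrix.of_apply, if_true, Matrix.smul_apply, Matrix.add_apply,
          Matrix.one_apply_eq, vecMulVec_apply, smul_eq_mul]
        field_simp
        ring
      · simp only [Matrix.of_apply, if_neg h, Matrix.smul_apply, Matrix.add_apply,
          Matrix.one_apply_ne h, vecMulVec_apply, smul_eq_mul]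
        field_simp
        ring
    rw [hA, vecMulVec_eq Unit, Matrix.det_smul, det_one_add_replicateCol_mul_replicateRow,
      Fintype.card_fin]
    simp only [dotProduct, one_mul, Finset.sum_const, Finset.card_univ, Fintype.card_fin,
      nsmul_eq_mul, Nat.cast_add, Nat.cast_one]
    field_simp
    ring

/-! ### The witness matrix `Mⁿ_v` and its permanent (proved) -/

section Witness

variable (F : Type u) [Field F]

/-- The Cai–Chen–Li witness matrix `Mⁿ_v` (p. 43, PDF p007:L37–p008:L1): the `(n+1) × (n+1)`
matrix with `M_{n+1,n+1} = v`, `M_{i,i} = M_{n+1,i} = M_{i,n+1} = 1` for `i ≤ n`, and `0` otherwise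
(identity bordered by a last row and column of ones, corner `v`), as a point of
`Fin (n+1) × Fin (n+1) → F` (index `Fin.last n` = the printed index `n+1`).
[cite: CaiChenLi2010, §2.2, p. 43] -/
def caiChenLiMatrix (n : ℕ) (v : F) : Fin (n + 1) × Fin (n + 1) → F := fun ij =>
  if ij.1 = Fin.last n ∧ ij.2 = Fin.last n then v
  else if ij.1 = ij.2 ∨ ij.1 = Fin.last n ∨ ij.2 = Fin.last n then 1 else 0

variable {F}

/-- Corner entry of `Mⁿ_v`: `M_{n+1,n+1} = v` (p. 43, PDF p007:L39). [cite: CaiChenLi2010, §2.2 (definition of `Mⁿ_v`), p. 43] -/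
theorem caiChenLiMatrix_last_last (n : ℕ) (v : F) :
    caiChenLiMatrix F n v (Fin.last n, Fin.last n) = v := by
  simp [caiChenLiMatrix]

/-- Diagonal entries of `Mⁿ_v` off the corner: `M_{i,i} = 1` for `i ≤ n` (p. 43, PDF p007:L39). [cite: CaiChenLi2010, §2.2 (definition of `Mⁿ_v`), p. 43] -/
theorem caiChenLiMatrix_diag {n : ℕ} (v : F) {i : Fin (n + 1)} (hi : i ≠ Fin.last n) :
    caiChenLiMatrix F n v (i, i) = 1 := by
  simp [caiChenLiMatrix, hi]

/-- Last row of `Mⁿ_v` off the corner: `M_{n+1,i} = 1` for `i ≤ n` (p. 43, PDF p007:L39). [cite: CaiChenLi2010, §2.2 (definition of `Mⁿ_v`), p. 43] -/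
theorem caiChenLiMatrix_row_last {n : ℕ} (v : F) {j : Fin (n + 1)} (hj : j ≠ Fin.last n) :
    caiChenLiMatrix F n v (Fin.last n, j) = 1 := by
  simp [caiChenLiMatrix, hj]

/-- Last column of `Mⁿ_v` off the corner: `M_{i,n+1} = 1` for `i ≤ n` (p. 43, PDF p007:L40). [cite: CaiChenLi2010, §2.2 (definition of `Mⁿ_v`), p. 43] -/
theorem caiChenLiMatrix_col_last {n : ℕ} (v : F) {i : Fin (n + 1)} (hi : i ≠ Fin.last n) :
    caiChenLiMatrix F n v (i, Fin.last n) = 1 := by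
  simp [caiChenLiMatrix, hi]

/-- All other entries of `Mⁿ_v` vanish: `M_{i,j} = 0` for `i ≠ j`, `i, j ≤ n` (p. 43, PDF p007:L40:
«`M_{i,j} = 0` otherwise»). [cite: CaiChenLi2010, §2.2 (definition of `Mⁿ_v`), p. 43] -/
theorem caiChenLiMatrix_eq_zero {n : ℕ} (v : F) {i j : Fin (n + 1)} (hij : i ≠ j)
    (hi : i ≠ Fin.last n) (hj : j ≠ Fin.last n) : caiChenLiMatrix F n v (i, j) = 0 := by
  simp [caiChenLiMatrix, hij, hi, hj]

/-- The diagonal term of `per(Mⁿ_v)`: `∏ᵢ M_{i,i} = v` (step of the printed «Clearly,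
`per(M) = n+1`»). [cite: CaiChenLi2010, Lemma 3.1 (proof, «per(M) = n+1»), p. 45] -/
private theorem prod_caiChenLiMatrix_one (n : ℕ) (v : F) :
    ∏ i : Fin (n + 1), caiChenLiMatrix F n v (i, i) = v := by
  rw [Fin.prod_univ_castSucc, caiChenLiMatrix_last_last, Finset.prod_eq_one, one_mul]
  intro j _
  exact caiChenLiMatrix_diag v (Fin.castSucc_lt_last j).ne

/-- The transposition terms of `per(Mⁿ_v)`: for `π = (j, n+1)`, `∏ᵢ M_{π i, i} = 1` (step of the
printed «Clearly, `per(M) = n+1`»). [cite: CaiChenLi2010, Lemma 3.1 (proof, «per(M) = n+1»), p. 45] -/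
private theorem prod_caiChenLiMatrix_swap {n : ℕ} (v : F) (j : Fin n) :
    ∏ i : Fin (n + 1), caiChenLiMatrix F n v (Equiv.swap (Fin.castSucc j) (Fin.last n) i, i) = 1 := by
  have hj : Fin.castSucc j ≠ Fin.last n := (Fin.castSucc_lt_last j).ne
  refine Finset.prod_eq_one fun i _ => ?_
  by_cases h1 : i = Fin.last n
  · subst h1
    rw [Equiv.swap_apply_right]
    exact caiChenLiMatrix_col_last v hj
  · by_cases h2 : i = Fin.castSucc j
    · subst h2
      rw [Equiv.swap_apply_left]
      exact caiChenLiMatrix_row_last v hj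
    · rw [Equiv.swap_apply_of_ne_of_ne h2 h1]
      exact caiChenLiMatrix_diag v h1

/-- All other permutation terms of `per(Mⁿ_v)` vanish: if `π ≠ 1` and `π` is not a transposition
`(j, n+1)`, some factor `M_{π i, i}` is an off-diagonal, off-border entry, i.e. `0` (step of the
printed «Clearly, `per(M) = n+1`»). [cite: CaiChenLi2010, Lemma 3.1 (proof, «per(M) = n+1»), p. 45] -/
private theorem prod_caiChenLiMatrix_eq_zero {n : ℕ} (v : F) (π : Equiv.Perm (Fin (n + 1))) (h1 : π ≠ 1)
    (h2 : ∀ j : Fin n, π ≠ Equiv.swap (Fin.castSucc j) (Fin.last n)) :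
    ∏ i : Fin (n + 1), caiChenLiMatrix F n v (π i, i) = 0 := by
  -- there is an index `i ≠ last` with `π i ∉ {i, last}`
  suffices h : ∃ i : Fin (n + 1), i ≠ Fin.last n ∧ π i ≠ i ∧ π i ≠ Fin.last n by
    obtain ⟨i, hi, hπi, hπl⟩ := h
    exact Finset.prod_eq_zero (Finset.mem_univ i) (caiChenLiMatrix_eq_zero v hπi hπl hi)
  by_contra H
  push Not at H
  -- `H : ∀ i, i ≠ last → π i ≠ i → π i = last`
  by_cases hl : π (Fin.last n) = Fin.last n
  · apply h1
    refine Equiv.ext fun i => ?_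
    by_cases hi : i = Fin.last n
    · rw [hi, hl, Equiv.Perm.one_apply]
    · rw [Equiv.Perm.one_apply]
      by_contra hne
      have := H i hi hne
      rw [← hl] at this
      exact hi (π.injective this)
  · -- `π last = castSucc j`; then `π = swap (castSucc j) last`
    obtain ⟨j, hj⟩ := Fin.exists_castSucc_eq.mpr hl
    have hjl : Fin.castSucc j ≠ Fin.last n := (Fin.castSucc_lt_last j).ne
    have hne' : π (Fin.castSucc j) ≠ Fin.castSucc j := fun h => hjl (π.injective (h.trans hj))
    have hπj : π (Fin.castSucc j) = Fin.last n := H _ hjl hne'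
    apply h2 j
    refine Equiv.ext fun i => ?_
    by_cases hi : i = Fin.last n
    · rw [hi, Equiv.swap_apply_right, hj]
    · by_cases hij : i = Fin.castSucc j
      · rw [hij, Equiv.swap_apply_left, hπj]
      · rw [Equiv.swap_apply_of_ne_of_ne hij hi]
        by_contra hne
        have hπi := H i hi hne
        exact hij (π.injective (hπi.trans hπj.symm))

/-- **`per(Mⁿ_v) = n + v`** (Cai–Chen–Li 2010, proof of Lemma 3.1, p. 45, PDF p009:L48: «Clearly,
`per(M) = n+1`» for `v = 1`; §4, p. 48, PDF p012:L32–L33 for `v = 1, 2`: «in both cases, we have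
`n ≡ −v (mod p)`»): the only permutations supported on the nonzero pattern of `Mⁿ_v` are the
identity (weight `v`) and the `n` transpositions `(j, n+1)` (weight `1` each). PROVED.
[cite: CaiChenLi2010, Lemma 3.1 (proof), p. 45] -/
theorem eval_caiChenLiMatrix_perPoly (n : ℕ) (v : F) :
    eval (caiChenLiMatrix F n v) (perPoly (Fin (n + 1)) F) = n + v := by
  rw [eval_perPoly]
  simp only [Matrix.permanent, Matrix.of_apply]
  rw [← Finset.add_sum_erase _ _ (Finset.mem_univ (1 : Equiv.Perm (Fin (n + 1))))]
  simp only [Equiv.Perm.one_apply]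
  rw [prod_caiChenLiMatrix_one]
  have hswap_ne_one : ∀ j : Fin n, Equiv.swap (Fin.castSucc j) (Fin.last n) ≠ 1 := by
    intro j h
    have := congrArg (fun σ : Equiv.Perm (Fin (n + 1)) => σ (Fin.last n)) h
    simp only [Equiv.swap_apply_right, Equiv.Perm.one_apply] at this
    exact (Fin.castSucc_lt_last j).ne this
  have hrest : ∑ π ∈ (Finset.univ : Finset (Equiv.Perm (Fin (n + 1)))).erase 1,
        ∏ i : Fin (n + 1), caiChenLiMatrix F n v (π i, i) =
      ∑ π ∈ (Finset.univ : Finset (Equiv.Perm (Fin (n + 1)))).erase 1, ∑ j : Fin n,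
        if π = Equiv.swap (Fin.castSucc j) (Fin.last n) then (1 : F) else 0 := by
    refine Finset.sum_congr rfl fun π hπ => ?_
    have hπ1 : π ≠ 1 := (Finset.mem_erase.mp hπ).1
    by_cases hsw : ∃ j : Fin n, π = Equiv.swap (Fin.castSucc j) (Fin.last n)
    · obtain ⟨j, rfl⟩ := hsw
      rw [prod_caiChenLiMatrix_swap, Finset.sum_eq_single j]
      · rw [if_pos rfl]
      · intro j' _ hj'
        rw [if_neg]
        intro h
        have := congrArg (fun σ : Equiv.Perm (Fin (n + 1)) => σ (Fin.last n)) h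
        simp only [Equiv.swap_apply_right] at this
        exact hj' (Fin.castSucc_injective _ this).symm
      · simp
    · push Not at hsw
      rw [prod_caiChenLiMatrix_eq_zero v π hπ1 hsw]
      exact (Finset.sum_eq_zero fun j _ => if_neg (hsw j)).symm
  rw [hrest, Finset.sum_comm]
  have hcol : ∀ j : Fin n, (∑ π ∈ (Finset.univ : Finset (Equiv.Perm (Fin (n + 1)))).erase 1,
      if π = Equiv.swap (Fin.castSucc j) (Fin.last n) then (1 : F) else 0) = 1 := by
    intro j
    rw [Finset.sum_ite_eq', if_pos (Finset.mem_erase.mpr ⟨hswap_ne_one j, Finset.mem_univ _⟩)]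
  simp only [hcol, Finset.sum_const, Finset.card_univ, Fintype.card_fin, nsmul_eq_mul, mul_one]
  ring

/-- Hence **`per(Mⁿ_v) = 0` in characteristic `p` when `p ∣ n + v`** — the «`per(X₀) ≡ 0 (mod p)`»
half of the witness claim in the printed proof of Thm. 2.3 (`v = 1` in case (i) where `p ∣ n+1`,
`v = 2` in case (ii) where `p ∣ n+2`; §4, p. 48) and the first assertion of Lemma 3.1 (p. 45).
PROVED. [cite: CaiChenLi2010, Lemma 3.1 / §4, pp. 45, 48] -/
theorem eval_caiChenLiMatrix_perPoly_eq_zero (p : ℕ) [CharP F p] {n v : ℕ} (h : p ∣ n + v) :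
    eval (caiChenLiMatrix F n (v : F)) (perPoly (Fin (n + 1)) F) = 0 := by
  rw [eval_caiChenLiMatrix_perPoly]
  exact_mod_cast (CharP.cast_eq_zero_iff F p (n + v)).mpr h

end Witness

/-! ### Consequences (proved from the fact) -/

/-- `dc(per_m)` is monotone in `m`: `per_m` is a Valiant projection of `per_{m'}` for `m ≤ m'`
(the tree's `isProjection_perPoly_of_le`, `PermanentMonotone.lean`) and `dc` does not increase
under projection (`determinantalComplexity_le_of_isProjection_holds`; Bürgisser 2000, §2.5).
[cite: Burgisser2000, §2.5] -/
theorem determinantalComplexity_perPoly_mono (F : Type u) [Field F] {m m' : ℕ} (h : m ≤ m') :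
    determinantalComplexity (perPoly (Fin m) F) ≤ determinantalComplexity (perPoly (Fin m') F) :=
  determinantalComplexity_le_of_isProjection_holds (isProjection_perPoly_of_le F h)

/-- **Cai–Chen–Li 2010, Theorem 2.3 ⇒ the determinantal bounds** (their §2.1 step, p. 42, in tree
as the Mignon–Ressayre rank bound `rank H_f(x) ≤ 2·dc(f)` at a zero, valid over any field:
`rank_hessianMatrix_le_two_mul_determinantalComplexity`): over a field of odd characteristic `p`,
(i) `p ≠ 23`, `n > 2`, `p ∣ n+1` ⇒ `(n−2)(n−3) ≤ 2·dc(per_{n+1})`; (ii) `p ∉ {3,5}`, `n > 1`,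
`p ∣ n+2` ⇒ `(n−2)(n−3) ≤ 2·dc(per_{n+1})`. PROVED from the fact `caiChenLi2010_thm_2_3`.
[cite: CaiChenLi2010, Thm. 2.3 and §2.1, pp. 42–43] -/
theorem caiChenLi2010_dc_of_thm_2_3 (h : caiChenLi2010_thm_2_3.{u}) (p : ℕ) [Fact p.Prime]
    (F : Type u) [Field F] [CharP F p] (hp : p ≠ 2) :
    (p ≠ 23 → ∀ n : ℕ, 2 < n → p ∣ n + 1 →
      (n - 2) * (n - 3) ≤ 2 * determinantalComplexity (perPoly (Fin (n + 1)) F)) ∧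
    (p ≠ 3 → p ≠ 5 → ∀ n : ℕ, 1 < n → p ∣ n + 2 →
      (n - 2) * (n - 3) ≤ 2 * determinantalComplexity (perPoly (Fin (n + 1)) F)) := by
  obtain ⟨h1, h2⟩ := h p F hp
  refine ⟨fun h23 n hn hdvd => ?_, fun h3 h5 n hn hdvd => ?_⟩
  · obtain ⟨X₀, hX₀, hrank⟩ := h1 h23 n hn hdvd
    exact hrank.trans (rank_hessianMatrix_le_two_mul_determinantalComplexity _ X₀ hX₀)
  · obtain ⟨X₀, hX₀, hrank⟩ := h2 h3 h5 n hn hdvd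
    exact hrank.trans (rank_hessianMatrix_le_two_mul_determinantalComplexity _ X₀ hX₀)

/-- **Cai–Chen–Li 2010, Corollary 2.4 (in the form the printed proof gives)**: for every prime
`p ≠ 2` and every field `F` of characteristic `p` there are infinitely many `n` — here: beyond
every `N` — with `(n−2)(n−3) ≤ 2·dc(per_{n+1})` over `F`. Printed (p. 43, PDF p007:L35–L36): «For
every prime `p ≠ 2`, there exist infinitely many positive integers `n` such that
`dc(per_n) ≥ (n−2)(n−3)/2` over a field of `char F = p`» — one index beyond what Thm. 2.3 (whose
witnesses are `(n+1) × (n+1)` matrices) and §2.1 give; see the module docstring. Proof: case (i)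
with `n = p(N+2) − 1` for `p ≠ 23`, case (ii) with `n = 23(N+2) − 2` for `p = 23`. PROVED from the
fact `caiChenLi2010_thm_2_3`. [cite: CaiChenLi2010, Cor. 2.4, p. 43] -/
theorem caiChenLi2010_cor_2_4 (h : caiChenLi2010_thm_2_3.{u}) (p : ℕ) [hp : Fact p.Prime]
    (F : Type u) [Field F] [CharP F p] (hp2 : p ≠ 2) (N : ℕ) :
    ∃ n : ℕ, N ≤ n ∧ (n - 2) * (n - 3) ≤ 2 * determinantalComplexity (perPoly (Fin (n + 1)) F) := by
  obtain ⟨h1, h2⟩ := caiChenLi2010_dc_of_thm_2_3 h p F hp2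
  have hp3 : 3 ≤ p := by
    have := hp.out.two_le
    omega
  have hmul : 3 * (N + 2) ≤ p * (N + 2) := Nat.mul_le_mul_right _ hp3
  by_cases h23 : p = 23
  · -- case (ii): `n = 23 (N+2) − 2`, so `23 ∣ n + 2`
    subst h23
    refine ⟨23 * (N + 2) - 2, by omega, ?_⟩
    have hn2 : 23 * (N + 2) - 2 + 2 = 23 * (N + 2) := by omega
    exact h2 (by omega) (by omega) _ (by omega)
      (show 23 ∣ 23 * (N + 2) - 2 + 2 by rw [hn2]; exact Dvd.intro _ rfl)
  · -- case (i): `n = p (N+2) − 1`, so `p ∣ n + 1`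
    refine ⟨p * (N + 2) - 1, by omega, ?_⟩
    have hn1 : p * (N + 2) - 1 + 1 = p * (N + 2) := by omega
    exact h1 h23 _ (by omega) (show p ∣ p * (N + 2) - 1 + 1 by rw [hn1]; exact Dvd.intro _ rfl)

/-- **The quadratic bound for ALL large `n` in odd characteristic** (consequence of Thm. 2.3 and
the monotonicity `dc(per_m) ≤ dc(per_n)`, `m ≤ n`): over a field of odd characteristic `p`, for
every `n ≥ p + 3`, `(n−p−2)(n−p−3) ≤ 2·dc(per_n)` — i.e. `dc(per_n) ≥ (½ − o(1))·n²` for each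
fixed odd `p`, the content of the title claim "quadratic lower bound … in any characteristic"
(take the largest `m ≤ n` with `m ≡ 0 (mod p)` and apply case (i) to `per_m = per_{(m−1)+1}`, or,
when `p = 23`, the largest `m ≤ n` with `m ≡ −1 (mod p)` and case (ii); in both cases
`m ≥ n − p + 1`). PROVED from the fact `caiChenLi2010_thm_2_3`.
[cite: CaiChenLi2010, Thm. 2.3 and Cor. 2.4 (consequence), p. 43] -/
theorem caiChenLi2010_eventually (h : caiChenLi2010_thm_2_3.{u}) (p : ℕ) [hp : Fact p.Prime]
    (F : Type u) [Field F] [CharP F p] (hp2 : p ≠ 2) {n : ℕ} (hn : p + 3 ≤ n) :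
    (n - p - 2) * (n - p - 3) ≤ 2 * determinantalComplexity (perPoly (Fin n) F) := by
  obtain ⟨h1, h2⟩ := caiChenLi2010_dc_of_thm_2_3 h p F hp2
  have hp3 : 3 ≤ p := by
    have := hp.out.two_le
    omega
  by_cases h23 : p = 23
  · -- case (ii): `M + 1 = p ⌊(n+1)/p⌋`, the largest `M ≤ n` with `M ≡ -1 (mod p)`
    set Q := p * ((n + 1) / p) with hQ
    have hQle : Q ≤ n + 1 := Nat.mul_div_le (n + 1) p
    have hQlt : n + 1 < Q + p := by
      have := Nat.lt_div_mul_add (a := n + 1) (b := p) (by omega)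
      rw [hQ]; linarith [Nat.mul_comm ((n + 1) / p) p]
    have hdvdQ : p ∣ Q := Dvd.intro _ rfl
    have hM2 : Q - 2 + 2 = Q := by omega
    have hstep := h2 (by omega) (by omega) (Q - 2) (by omega) (hM2.symm ▸ hdvdQ)
    calc (n - p - 2) * (n - p - 3) ≤ (Q - 2 - 2) * (Q - 2 - 3) :=
          Nat.mul_le_mul (by omega) (by omega)
      _ ≤ 2 * determinantalComplexity (perPoly (Fin (Q - 2 + 1)) F) := hstep
      _ ≤ 2 * determinantalComplexity (perPoly (Fin n) F) :=
          Nat.mul_le_mul_left 2 (determinantalComplexity_perPoly_mono F (by omega))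
  · -- case (i): `M = p ⌊n/p⌋`, the largest multiple of `p` below `n`: `n - p < M ≤ n`
    set M := p * (n / p) with hM
    have hMle : M ≤ n := Nat.mul_div_le n p
    have hMlt : n < M + p := by
      have := Nat.lt_div_mul_add (a := n) (b := p) (by omega)
      rw [hM]; linarith [Nat.mul_comm (n / p) p]
    have hdvd : p ∣ M := Dvd.intro _ rfl
    have hM1 : M - 1 + 1 = M := by omega
    have hstep := h1 h23 (M - 1) (by omega) (hM1.symm ▸ hdvd)
    calc (n - p - 2) * (n - p - 3) ≤ (M - 1 - 2) * (M - 1 - 3) :=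
          Nat.mul_le_mul (by omega) (by omega)
      _ ≤ 2 * determinantalComplexity (perPoly (Fin (M - 1 + 1)) F) := hstep
      _ ≤ 2 * determinantalComplexity (perPoly (Fin n) F) :=
          Nat.mul_le_mul_left 2 (determinantalComplexity_perPoly_mono F (by omega))

/-! ### Lemma 2.5 (proved): the Hessian of `per` at `Mⁿ_v` on `S × S` -/

section HessianEntries

variable {F : Type u} [Field F]

/-- Support of the pattern of `Mⁿ_v`: a permutation `π ≠ 1` which is not a transposition
`(t₀, n+1)` moves some non-last index `i` to a non-last index `≠ i` (where `M_{π i, i} = 0`); the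
combinatorial core of «Clearly, `per(M) = n+1`» and of Lemma 2.5's case analysis.
[cite: CaiChenLi2010, Lemma 2.5 / Lemma 3.1 (proofs), pp. 44–45] -/
private theorem exists_off_pattern {n : ℕ} (π : Equiv.Perm (Fin (n + 1))) (h1 : π ≠ 1)
    (h2 : ∀ t₀ : Fin (n + 1), t₀ ≠ Fin.last n → π ≠ Equiv.swap t₀ (Fin.last n)) :
    ∃ i : Fin (n + 1), i ≠ Fin.last n ∧ π i ≠ i ∧ π i ≠ Fin.last n := by
  by_contra H
  push Not at H
  by_cases hl : π (Fin.last n) = Fin.last n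
  · apply h1
    refine Equiv.ext fun i => ?_
    by_cases hi : i = Fin.last n
    · rw [hi, hl, Equiv.Perm.one_apply]
    · rw [Equiv.Perm.one_apply]
      by_contra hne
      have := H i hi hne
      rw [← hl] at this
      exact hi (π.injective this)
  · set t₀ := π (Fin.last n) with ht₀
    have hne' : π t₀ ≠ t₀ := fun h => hl (π.injective h)
    have hπt : π t₀ = Fin.last n := H _ hl hne'
    apply h2 t₀ hl
    refine Equiv.ext fun i => ?_
    by_cases hi : i = Fin.last n
    · rw [hi, Equiv.swap_apply_right]
    · by_cases hit : i = t₀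
      · rw [hit, Equiv.swap_apply_left, hπt]
      · rw [Equiv.swap_apply_of_ne_of_ne hit hi]
        by_contra hne
        exact hit (π.injective ((H i hi hne).trans hπt.symm))

/-- **Generalized permanent count for the pattern of `Mⁿ_v`**: for a set `D` of non-last indices,
`Σ_{σ fixing D pointwise} ∏_{t ∉ D} M_{σ t, t} = v + (n − |D|)` — the surviving permutations are the
identity (weight `v`) and the transpositions `(t₀, n+1)` with `t₀ ∉ D` (weight `1` each). For
`D = ∅` this is `per(Mⁿ_v) = n + v`; for `D = {i, j}` it is the sub-permanent behind
`H_{ij,ji}(Mⁿ_v) = v + n − 2` (Lemma 2.5, first case). [cite: CaiChenLi2010, Lemma 2.5 / Lemma 3.1 (proofs), pp. 44–45] -/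
theorem sum_perm_fix_prod_caiChenLiMatrix {n : ℕ} (v : F) (D : Finset (Fin (n + 1)))
    (hD : Fin.last n ∉ D) :
    ∑ σ ∈ (Finset.univ : Finset (Equiv.Perm (Fin (n + 1)))).filter (fun σ => ∀ d ∈ D, σ d = d),
      ∏ t ∈ Finset.univ \ D, caiChenLiMatrix F n v (σ t, t) = v + ((n - D.card : ℕ) : F) := by
  classical
  set S := (Finset.univ : Finset (Equiv.Perm (Fin (n + 1)))).filter (fun σ => ∀ d ∈ D, σ d = d)
    with hS
  set T := (Finset.univ \ D).erase (Fin.last n) with hT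
  have hlast : Fin.last n ∈ Finset.univ \ D := Finset.mem_sdiff.mpr ⟨Finset.mem_univ _, hD⟩
  have h1S : (1 : Equiv.Perm (Fin (n + 1))) ∈ S := by simp [hS]
  -- membership facts
  have hT_mem : ∀ {t}, t ∈ T ↔ t ∉ D ∧ t ≠ Fin.last n := by
    intro t
    simp [hT, Finset.mem_erase, Finset.mem_sdiff, and_comm]
  have hswapS : ∀ t ∈ T, Equiv.swap t (Fin.last n) ∈ S.erase 1 := by
    intro t ht
    obtain ⟨htD, htl⟩ := hT_mem.mp ht
    refine Finset.mem_erase.mpr ⟨?_, ?_⟩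
    · intro h
      have := congrArg (fun σ : Equiv.Perm (Fin (n + 1)) => σ (Fin.last n)) h
      simp only [Equiv.swap_apply_right, Equiv.Perm.one_apply] at this
      exact htl this
    · simp only [hS, Finset.mem_filter, Finset.mem_univ, true_and]
      intro d hd
      exact Equiv.swap_apply_of_ne_of_ne (fun h => htD (h ▸ hd)) (fun h => hD (h ▸ hd))
  -- split off `σ = 1`
  rw [← Finset.add_sum_erase _ _ h1S]
  have hone : ∏ t ∈ Finset.univ \ D, caiChenLiMatrix F n v ((1 : Equiv.Perm (Fin (n + 1))) t, t)
      = v := by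
    rw [Finset.prod_eq_prod_sdiff_singleton_mul hlast, Equiv.Perm.one_apply,
      caiChenLiMatrix_last_last, Finset.prod_eq_one, one_mul]
    intro t ht
    rw [Equiv.Perm.one_apply]
    exact caiChenLiMatrix_diag v (by simpa using (Finset.mem_sdiff.mp ht).2)
  rw [hone]
  -- the remaining permutations: transpositions `(t₀, last)`, `t₀ ∈ T`, weight `1`; others `0`
  have hrest : ∑ σ ∈ S.erase 1, ∏ t ∈ Finset.univ \ D, caiChenLiMatrix F n v (σ t, t) =
      ∑ σ ∈ S.erase 1, ∑ t₀ ∈ T, if σ = Equiv.swap t₀ (Fin.last n) then (1 : F) else 0 := by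
    refine Finset.sum_congr rfl fun σ hσ => ?_
    obtain ⟨hσ1, hσS⟩ := Finset.mem_erase.mp hσ
    have hfix : ∀ d ∈ D, σ d = d := by simpa [hS] using hσS
    by_cases hsw : ∃ t₀ ∈ T, σ = Equiv.swap t₀ (Fin.last n)
    · obtain ⟨t₀, ht₀, rfl⟩ := hsw
      obtain ⟨ht₀D, ht₀l⟩ := hT_mem.mp ht₀
      rw [Finset.sum_eq_single_of_mem t₀ ht₀, if_pos rfl]
      · refine Finset.prod_eq_one fun t ht => ?_
        have htD : t ∉ D := (Finset.mem_sdiff.mp ht).2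
        by_cases h1 : t = Fin.last n
        · rw [h1, Equiv.swap_apply_right]
          exact caiChenLiMatrix_col_last v ht₀l
        · by_cases h2 : t = t₀
          · rw [h2, Equiv.swap_apply_left]
            exact caiChenLiMatrix_row_last v ht₀l
          · rw [Equiv.swap_apply_of_ne_of_ne h2 h1]
            exact caiChenLiMatrix_diag v h1
      · intro t _ htne
        rw [if_neg]
        intro h
        have := congrArg (fun σ : Equiv.Perm (Fin (n + 1)) => σ (Fin.last n)) h
        simp only [Equiv.swap_apply_right] at this
        exact htne this.symm
    · push Not at hsw
      have h2 : ∀ t₀ : Fin (n + 1), t₀ ≠ Fin.last n → σ ≠ Equiv.swap t₀ (Fin.last n) := by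
        intro t₀ ht₀l h
        have ht₀D : t₀ ∉ D := by
          intro hmem
          have := hfix t₀ hmem
          rw [h, Equiv.swap_apply_left] at this
          exact ht₀l this.symm
        exact hsw t₀ (hT_mem.mpr ⟨ht₀D, ht₀l⟩) h
      obtain ⟨i, hil, hπi, hπl⟩ := exists_off_pattern σ hσ1 h2
      have hiD : i ∈ Finset.univ \ D :=
        Finset.mem_sdiff.mpr ⟨Finset.mem_univ _, fun hmem => hπi (hfix i hmem)⟩
      rw [Finset.prod_eq_zero hiD (caiChenLiMatrix_eq_zero v hπi hπl hil)]
      exact (Finset.sum_eq_zero fun t ht => if_neg (hsw t ht)).symm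
  rw [hrest, Finset.sum_comm]
  have hcol : ∀ t₀ ∈ T, (∑ σ ∈ S.erase 1,
      if σ = Equiv.swap t₀ (Fin.last n) then (1 : F) else 0) = 1 := by
    intro t₀ ht₀
    rw [Finset.sum_ite_eq', if_pos (hswapS t₀ ht₀)]
  rw [Finset.sum_congr rfl hcol, Finset.sum_const, nsmul_eq_mul, mul_one]
  -- `|T| = n − |D|`
  have hcard : T.card = n - D.card := by
    rw [hT, Finset.card_erase_of_mem hlast, Finset.card_sdiff_of_subset (Finset.subset_univ D), Finset.card_univ,
      Fintype.card_fin]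
    omega
  rw [hcard]

/-- **Cai–Chen–Li 2010, Lemma 2.5, first case** (p. 44, PDF p008:L9–L13): for `1 ≤ i ≠ j ≤ n`,
`H_{ij,ji}(Mⁿ_v) = v + n − 2`, where `H_{ij,kl} = ∂²per/∂x_{ij}∂x_{kl}` at `Mⁿ_v` (tree:
`hessianMatrix (perPoly (Fin (n+1)) F) (caiChenLiMatrix F n v) (j,i) (i,j)`, variables indexed
(row, column), non-last indices `i, j`). PROVED: the second partial is the sub-permanent of `Mⁿ_v`
with rows and columns `i, j` removed (`hess0_transl_perPoly`), counted by
`sum_perm_fix_prod_caiChenLiMatrix` with `D = {i, j}`. [cite: CaiChenLi2010, Lemma 2.5 (first case), p. 44] -/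
theorem caiChenLi2010_lemma_2_5_transpose {n : ℕ} (v : F) {i j : Fin (n + 1)} (hij : i ≠ j)
    (hi : i ≠ Fin.last n) (hj : j ≠ Fin.last n) :
    hessianMatrix (perPoly (Fin (n + 1)) F) (caiChenLiMatrix F n v) (j, i) (i, j) =
      v + ((n - 2 : ℕ) : F) := by
  classical
  rw [hessianMatrix_apply, ← hess0_transl, hess0_transl_perPoly]
  -- reindex `π = σ * swap i j`
  rw [← Equiv.sum_comp (Equiv.mulRight (Equiv.swap i j))]
  simp only [Equiv.coe_mulRight, Equiv.Perm.mul_apply, Equiv.swap_apply_right,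
    Equiv.swap_apply_left]
  have hE : (Finset.univ.erase j).erase i = Finset.univ \ ({i, j} : Finset (Fin (n + 1))) := by
    ext t
    simp [Finset.mem_erase, Finset.mem_sdiff]
  have hD : Fin.last n ∉ ({i, j} : Finset (Fin (n + 1))) := by
    simp [Finset.mem_insert, Finset.mem_singleton, Ne.symm hi, Ne.symm hj]
  have hcard : ({i, j} : Finset (Fin (n + 1))).card = 2 := Finset.card_pair hij
  have key := sum_perm_fix_prod_caiChenLiMatrix (F := F) v ({i, j} : Finset (Fin (n + 1))) hD
  rw [hcard, Finset.sum_filter] at key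
  rw [← key, hE]
  refine Finset.sum_congr rfl fun σ _ => ?_
  have hcond : (σ i = i ∧ i ≠ j ∧ σ j = j) ↔ (∀ d ∈ ({i, j} : Finset (Fin (n + 1))), σ d = d) := by
    simp only [Finset.mem_insert, Finset.mem_singleton, forall_eq_or_imp, forall_eq]
    exact ⟨fun h => ⟨h.1, h.2.2⟩, fun h => ⟨h.1, hij, h.2⟩⟩
  by_cases hc : σ i = i ∧ i ≠ j ∧ σ j = j
  · rw [if_pos hc, if_pos (hcond.mp hc)]
    refine Finset.prod_congr rfl fun t ht => ?_
    have ht' : t ≠ i ∧ t ≠ j := by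
      simpa [Finset.mem_sdiff, Finset.mem_insert, Finset.mem_singleton, not_or] using ht
    rw [Equiv.swap_apply_of_ne_of_ne ht'.1 ht'.2]
  · rw [if_neg hc, if_neg (fun h => hc (hcond.mpr h))]


/-- One more index pinned to the last row: among the permutations fixing a set `D` of non-last
indices and sending a further non-last index `l ∉ D` to `last`, only the transposition `(l, n+1)`
is supported on the pattern of `Mⁿ_v`, with weight `1`. [cite: CaiChenLi2010, Lemma 2.5 (proof), p. 44] -/
theorem sum_perm_fix_pin_prod_caiChenLiMatrix {n : ℕ} (v : F) (D : Finset (Fin (n + 1)))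
    (hD : Fin.last n ∉ D) {l : Fin (n + 1)} (hlD : l ∉ D) (hl : l ≠ Fin.last n) :
    ∑ σ ∈ (Finset.univ : Finset (Equiv.Perm (Fin (n + 1)))).filter
        (fun σ => (∀ d ∈ D, σ d = d) ∧ σ l = Fin.last n),
      ∏ t ∈ Finset.univ \ insert l D, caiChenLiMatrix F n v (σ t, t) = 1 := by
  classical
  have hmem : Equiv.swap l (Fin.last n) ∈ (Finset.univ : Finset (Equiv.Perm (Fin (n + 1)))).filter
      (fun σ => (∀ d ∈ D, σ d = d) ∧ σ l = Fin.last n) := by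
    simp only [Finset.mem_filter, Finset.mem_univ, true_and, Equiv.swap_apply_left, and_true]
    intro d hd
    exact Equiv.swap_apply_of_ne_of_ne (fun h => hlD (h ▸ hd)) (fun h => hD (h ▸ hd))
  rw [Finset.sum_eq_single_of_mem _ hmem]
  · -- weight of `swap l last`
    refine Finset.prod_eq_one fun t ht => ?_
    have ht' : t ≠ l ∧ t ∉ D := by simpa [Finset.mem_sdiff, Finset.mem_insert, not_or] using ht
    by_cases h1 : t = Fin.last n
    · rw [h1, Equiv.swap_apply_right]
      exact caiChenLiMatrix_col_last v hl
    · rw [Equiv.swap_apply_of_ne_of_ne ht'.1 h1]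
      exact caiChenLiMatrix_diag v h1
  · -- every other admissible `σ` has a vanishing factor
    intro σ hσ hne
    obtain ⟨hfix, hσl⟩ := (Finset.mem_filter.mp hσ).2
    -- some `t ∉ D ∪ {l, last}` with `σ t ∉ {t, last}`
    suffices h : ∃ t, t ∉ insert l D ∧ t ≠ Fin.last n ∧ σ t ≠ t ∧ σ t ≠ Fin.last n by
      obtain ⟨t, ht, htl, hσt, hσtl⟩ := h
      exact Finset.prod_eq_zero (Finset.mem_sdiff.mpr ⟨Finset.mem_univ _, ht⟩)
        (caiChenLiMatrix_eq_zero v hσt hσtl htl)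
    by_contra H
    push Not at H
    apply hne
    refine Equiv.ext fun t => ?_
    by_cases htl : t = Fin.last n
    · -- `σ last = l`: the only value left
      rw [htl, Equiv.swap_apply_right]
      -- `σ (σ last)`: if `σ last ≠ l` then `σ last` is fixed by `σ` or sent to last — contradiction
      by_contra hlast
      have hsl : σ (Fin.last n) ≠ Fin.last n := by
        intro h; exact hl (σ.injective (hσl.trans h.symm)) |>.elim
      set u := σ (Fin.last n) with hu
      have huD : u ∉ insert l D := by
        intro hmem
        rcases Finset.mem_insert.mp hmem with h | h
        · exact hlast h
        · exact hsl (σ.injective (hfix u h))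
      have hσu : σ u ≠ u := fun h => hsl (σ.injective h)
      have := H u huD hsl hσu
      -- `σ u = last = σ l` ⇒ `u = l`
      exact hlast (σ.injective (this.trans hσl.symm))
    · by_cases htl' : t = l
      · rw [htl', Equiv.swap_apply_left, hσl]
      · rw [Equiv.swap_apply_of_ne_of_ne htl' htl]
        by_cases htD : t ∈ D
        · exact hfix t htD
        · by_contra hσt
          have := H t (by simp [Finset.mem_insert, htl', htD]) htl hσt
          exact htl' (σ.injective (this.trans hσl.symm))

/-- A factor `M_{σ l, y}` with `y ∈ D` fixed by `σ`, `l ∉ D`, `y` non-last, is the indicator of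
`σ l = last`. [cite: CaiChenLi2010, Lemma 2.5 (proof), p. 44] -/
private theorem caiChenLiMatrix_apply_eq_ite {n : ℕ} (v : F) (σ : Equiv.Perm (Fin (n + 1)))
    {l y : Fin (n + 1)} (hly : l ≠ y) (hσy : σ y = y) (hy : y ≠ Fin.last n) :
    caiChenLiMatrix F n v (σ l, y) = if σ l = Fin.last n then 1 else 0 := by
  by_cases h : σ l = Fin.last n
  · rw [if_pos h, h]
    exact caiChenLiMatrix_row_last v hy
  · rw [if_neg h]
    have hne : σ l ≠ y := fun h' => hly (σ.injective (h'.trans hσy.symm))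
    exact caiChenLiMatrix_eq_zero v hne h hy

/-- **Cai–Chen–Li 2010, Lemma 2.5, second and third cases** in reindexed form: for a set `D` of
non-last indices fixed by `σ`, `y ∈ D`, and a non-last `l ∉ D`,
`Σ_{σ fixing D} M_{σ l, y} · ∏_{t ∉ D ∪ {l}} M_{σ t, t} = 1`. [cite: CaiChenLi2010, Lemma 2.5 (proof), p. 44] -/
theorem sum_perm_fix_mul_prod_caiChenLiMatrix {n : ℕ} (v : F) (D : Finset (Fin (n + 1)))
    (hD : Fin.last n ∉ D) {l y : Fin (n + 1)} (hlD : l ∉ D) (hl : l ≠ Fin.last n) (hy : y ∈ D) :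
    ∑ σ ∈ (Finset.univ : Finset (Equiv.Perm (Fin (n + 1)))).filter (fun σ => ∀ d ∈ D, σ d = d),
      caiChenLiMatrix F n v (σ l, y) * ∏ t ∈ Finset.univ \ insert l D, caiChenLiMatrix F n v (σ t, t)
      = 1 := by
  classical
  have hyl : y ≠ Fin.last n := fun h => hD (h ▸ hy)
  have hly : l ≠ y := fun h => hlD (h ▸ hy)
  calc ∑ σ ∈ (Finset.univ : Finset (Equiv.Perm (Fin (n + 1)))).filter (fun σ => ∀ d ∈ D, σ d = d),
        caiChenLiMatrix F n v (σ l, y) *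
          ∏ t ∈ Finset.univ \ insert l D, caiChenLiMatrix F n v (σ t, t)
      = ∑ σ ∈ (Finset.univ : Finset (Equiv.Perm (Fin (n + 1)))).filter (fun σ => ∀ d ∈ D, σ d = d),
          if σ l = Fin.last n then ∏ t ∈ Finset.univ \ insert l D, caiChenLiMatrix F n v (σ t, t)
          else 0 := by
        refine Finset.sum_congr rfl fun σ hσ => ?_
        have hfix : ∀ d ∈ D, σ d = d := by simpa using hσ
        rw [caiChenLiMatrix_apply_eq_ite v σ hly (hfix y hy) hyl]
        split_ifs <;> simp
    _ = ∑ σ ∈ ((Finset.univ : Finset (Equiv.Perm (Fin (n + 1)))).filter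
          (fun σ => ∀ d ∈ D, σ d = d)).filter (fun σ => σ l = Fin.last n),
          ∏ t ∈ Finset.univ \ insert l D, caiChenLiMatrix F n v (σ t, t) :=
        (Finset.sum_filter _ _).symm
    _ = 1 := by
        rw [Finset.filter_filter]
        exact sum_perm_fix_pin_prod_caiChenLiMatrix v D hD hlD hl


/-- **Cai–Chen–Li 2010, Lemma 2.5, second case** (p. 44, PDF p008:L14): for `k = j` and
`l ∉ {i, j}`, `H_{ij,jl}(Mⁿ_v) = 1`. PROVED (reindex by the 3-cycle `j ↦ i ↦ l ↦ j`, then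
`sum_perm_fix_mul_prod_caiChenLiMatrix` with `D = {i,j}`, `y = i`). [cite: CaiChenLi2010, Lemma 2.5 (second case), p. 44] -/
theorem caiChenLi2010_lemma_2_5_case2 {n : ℕ} (v : F) {i j l : Fin (n + 1)} (hij : i ≠ j)
    (hli : l ≠ i) (hlj : l ≠ j) (hi : i ≠ Fin.last n) (hj : j ≠ Fin.last n)
    (hl : l ≠ Fin.last n) :
    hessianMatrix (perPoly (Fin (n + 1)) F) (caiChenLiMatrix F n v) (j, l) (i, j) = 1 := by
  classical
  rw [hessianMatrix_apply, ← hess0_transl, hess0_transl_perPoly]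
  set ρ : Equiv.Perm (Fin (n + 1)) := Equiv.swap j l * Equiv.swap i j with hρ
  have hρj : ρ j = i := by
    rw [hρ, Equiv.Perm.mul_apply, Equiv.swap_apply_right,
      Equiv.swap_apply_of_ne_of_ne hij (Ne.symm hli)]
  have hρl : ρ l = j := by
    rw [hρ, Equiv.Perm.mul_apply, Equiv.swap_apply_of_ne_of_ne hli hlj, Equiv.swap_apply_right]
  have hρi : ρ i = l := by
    rw [hρ, Equiv.Perm.mul_apply, Equiv.swap_apply_left, Equiv.swap_apply_left]
  have hρt : ∀ t, t ≠ i → t ≠ j → t ≠ l → ρ t = t := by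
    intro t h1 h2 h3
    rw [hρ, Equiv.Perm.mul_apply, Equiv.swap_apply_of_ne_of_ne h1 h2,
      Equiv.swap_apply_of_ne_of_ne h2 h3]
  rw [← Equiv.sum_comp (Equiv.mulRight ρ)]
  simp only [Equiv.coe_mulRight, Equiv.Perm.mul_apply, hρj, hρl]
  have hD : Fin.last n ∉ ({i, j} : Finset (Fin (n + 1))) := by
    simp [Finset.mem_insert, Finset.mem_singleton, Ne.symm hi, Ne.symm hj]
  have hlD : l ∉ ({i, j} : Finset (Fin (n + 1))) := by
    simp [Finset.mem_insert, Finset.mem_singleton, hli, hlj]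
  have key := sum_perm_fix_mul_prod_caiChenLiMatrix (F := F) v ({i, j} : Finset (Fin (n + 1))) hD
    hlD hl (y := i) (by simp)
  rw [Finset.sum_filter] at key
  rw [← key]
  have hEi : i ∈ (Finset.univ.erase j).erase l := by simp [Finset.mem_erase, hij, hli.symm]
  have hErase : ((Finset.univ.erase j).erase l).erase i =
      Finset.univ \ insert l ({i, j} : Finset (Fin (n + 1))) := by
    ext t
    simp [Finset.mem_erase, Finset.mem_sdiff]
    tauto
  refine Finset.sum_congr rfl fun σ _ => ?_
  have hcond : (σ i = i ∧ l ≠ j ∧ σ j = j) ↔ (∀ d ∈ ({i, j} : Finset (Fin (n + 1))), σ d = d) := by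
    simp only [Finset.mem_insert, Finset.mem_singleton, forall_eq_or_imp, forall_eq]
    exact ⟨fun h => ⟨h.1, h.2.2⟩, fun h => ⟨h.1, hlj, h.2⟩⟩
  by_cases hc : σ i = i ∧ l ≠ j ∧ σ j = j
  · rw [if_pos hc, if_pos (hcond.mp hc), ← Finset.mul_prod_erase _ _ hEi, hρi, hErase]
    congr 1
    refine Finset.prod_congr rfl fun t ht => ?_
    have ht' : t ≠ l ∧ t ≠ i ∧ t ≠ j := by
      simpa [Finset.mem_sdiff, Finset.mem_insert, Finset.mem_singleton, not_or] using ht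
    rw [hρt t ht'.2.1 ht'.2.2 ht'.1]
  · rw [if_neg hc, if_neg (fun h => hc (hcond.mpr h))]

/-- **Cai–Chen–Li 2010, Lemma 2.5, third case** (p. 44, PDF p008:L15): for `l = i` and
`k ∉ {i, j}`, `H_{ij,ki}(Mⁿ_v) = 1`. PROVED (reindex by the 3-cycle `j ↦ i ↦ k ↦ j`, then
`sum_perm_fix_mul_prod_caiChenLiMatrix` with `D = {i,k}`, `y = k`). [cite: CaiChenLi2010, Lemma 2.5 (third case), p. 44] -/
theorem caiChenLi2010_lemma_2_5_case3 {n : ℕ} (v : F) {i j k : Fin (n + 1)} (hij : i ≠ j)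
    (hki : k ≠ i) (hkj : k ≠ j) (hi : i ≠ Fin.last n) (hj : j ≠ Fin.last n)
    (hk : k ≠ Fin.last n) :
    hessianMatrix (perPoly (Fin (n + 1)) F) (caiChenLiMatrix F n v) (k, i) (i, j) = 1 := by
  classical
  rw [hessianMatrix_apply, ← hess0_transl, hess0_transl_perPoly]
  set ρ : Equiv.Perm (Fin (n + 1)) := Equiv.swap j i * Equiv.swap i k with hρ
  have hρj : ρ j = i := by
    rw [hρ, Equiv.Perm.mul_apply, Equiv.swap_apply_of_ne_of_ne (Ne.symm hij) (Ne.symm hkj),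
      Equiv.swap_apply_left]
  have hρi : ρ i = k := by
    rw [hρ, Equiv.Perm.mul_apply, Equiv.swap_apply_left, Equiv.swap_apply_of_ne_of_ne hkj hki]
  have hρk : ρ k = j := by
    rw [hρ, Equiv.Perm.mul_apply, Equiv.swap_apply_right, Equiv.swap_apply_right]
  have hρt : ∀ t, t ≠ i → t ≠ j → t ≠ k → ρ t = t := by
    intro t h1 h2 h3
    rw [hρ, Equiv.Perm.mul_apply, Equiv.swap_apply_of_ne_of_ne h1 h3,
      Equiv.swap_apply_of_ne_of_ne h2 h1]
  rw [← Equiv.sum_comp (Equiv.mulRight ρ)]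
  simp only [Equiv.coe_mulRight, Equiv.Perm.mul_apply, hρj, hρi]
  have hD : Fin.last n ∉ ({i, k} : Finset (Fin (n + 1))) := by
    simp [Finset.mem_insert, Finset.mem_singleton, Ne.symm hi, Ne.symm hk]
  have hjD : j ∉ ({i, k} : Finset (Fin (n + 1))) := by
    simp [Finset.mem_insert, Finset.mem_singleton, hij.symm, hkj.symm]
  have key := sum_perm_fix_mul_prod_caiChenLiMatrix (F := F) v ({i, k} : Finset (Fin (n + 1))) hD
    hjD hj (y := k) (by simp)
  rw [Finset.sum_filter] at key
  rw [← key]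
  have hEk : k ∈ (Finset.univ.erase j).erase i := by simp [Finset.mem_erase, hki, hkj]
  have hErase : ((Finset.univ.erase j).erase i).erase k =
      Finset.univ \ insert j ({i, k} : Finset (Fin (n + 1))) := by
    ext t
    simp [Finset.mem_erase, Finset.mem_sdiff]
    tauto
  refine Finset.sum_congr rfl fun σ _ => ?_
  have hcond : (σ i = i ∧ i ≠ j ∧ σ k = k) ↔ (∀ d ∈ ({i, k} : Finset (Fin (n + 1))), σ d = d) := by
    simp only [Finset.mem_insert, Finset.mem_singleton, forall_eq_or_imp, forall_eq]
    exact ⟨fun h => ⟨h.1, h.2.2⟩, fun h => ⟨h.1, hij, h.2⟩⟩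
  by_cases hc : σ i = i ∧ i ≠ j ∧ σ k = k
  · rw [if_pos hc, if_pos (hcond.mp hc), ← Finset.mul_prod_erase _ _ hEk, hρk, hErase]
    congr 1
    refine Finset.prod_congr rfl fun t ht => ?_
    have ht' : t ≠ j ∧ t ≠ i ∧ t ≠ k := by
      simpa [Finset.mem_sdiff, Finset.mem_insert, Finset.mem_singleton, not_or] using ht
    rw [hρt t ht'.2.1 ht'.1 ht'.2.2]
  · rw [if_neg hc, if_neg (fun h => hc (hcond.mpr h))]

/-- **Cai–Chen–Li 2010, Lemma 2.5, vanishing cases, (a) `k = i`**: `H_{ij,il}(Mⁿ_v) = 0` — no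
permutation sends both columns `j` and `l` to row `i` (and for `l = j` the entry is the excluded
diagonal one). [cite: CaiChenLi2010, Lemma 2.5 (fourth case), p. 44] -/
theorem caiChenLi2010_lemma_2_5_zero_a {n : ℕ} (v : F) {i j l : Fin (n + 1)} :
    l ≠ i → hessianMatrix (perPoly (Fin (n + 1)) F) (caiChenLiMatrix F n v) (i, l) (i, j) = 0 := by
  classical
  intro _
  rw [hessianMatrix_apply, ← hess0_transl, hess0_transl_perPoly]
  refine Finset.sum_eq_zero fun π _ => ?_
  rw [if_neg]
  rintro ⟨h1, h2, h3⟩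
  exact h2 (π.injective (h3.trans h1.symm))

/-- **Cai–Chen–Li 2010, Lemma 2.5, vanishing cases, (b) `l = j`**: `H_{ij,kj}(Mⁿ_v) = 0` (two
derivatives in the same column). [cite: CaiChenLi2010, Lemma 2.5 (fourth case), p. 44] -/
theorem caiChenLi2010_lemma_2_5_zero_b {n : ℕ} (v : F) {i j k : Fin (n + 1)} :
    hessianMatrix (perPoly (Fin (n + 1)) F) (caiChenLiMatrix F n v) (k, j) (i, j) = 0 := by
  classical
  rw [hessianMatrix_apply, ← hess0_transl, hess0_transl_perPoly]
  refine Finset.sum_eq_zero fun π _ => ?_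
  rw [if_neg]
  rintro ⟨_, h2, _⟩
  exact h2 rfl

/-- **Cai–Chen–Li 2010, Lemma 2.5, vanishing cases, (c) `{k,l} ∩ {i,j} = ∅`**:
`H_{ij,kl}(Mⁿ_v) = 0` — every permutation with `π j = i`, `π l = k` has a vanishing factor (at
column `i` if `π i ≠ last`, else at column `k`). [cite: CaiChenLi2010, Lemma 2.5 (fourth case), p. 44] -/
theorem caiChenLi2010_lemma_2_5_zero_c {n : ℕ} (v : F) {i j k l : Fin (n + 1)} (hij : i ≠ j)
    (hkl : k ≠ l) (hki : k ≠ i) (hkj : k ≠ j) (hli : l ≠ i)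
    (hi : i ≠ Fin.last n) (hk : k ≠ Fin.last n) :
    hessianMatrix (perPoly (Fin (n + 1)) F) (caiChenLiMatrix F n v) (k, l) (i, j) = 0 := by
  classical
  rw [hessianMatrix_apply, ← hess0_transl, hess0_transl_perPoly]
  refine Finset.sum_eq_zero fun π _ => ?_
  split_ifs with h
  · obtain ⟨h1, _, h3⟩ := h
    by_cases hπi : π i = Fin.last n
    · -- factor at column `k`
      have hkE : k ∈ (Finset.univ.erase j).erase l := by simp [Finset.mem_erase, hkl, hkj]
      refine Finset.prod_eq_zero hkE (caiChenLiMatrix_eq_zero v ?_ ?_ hk)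
      · intro h
        exact hkl (π.injective (h.trans h3.symm))
      · intro h
        exact hki (π.injective (h.trans hπi.symm))
    · -- factor at column `i`
      have hiE : i ∈ (Finset.univ.erase j).erase l := by simp [Finset.mem_erase, hij, hli.symm]
      refine Finset.prod_eq_zero hiE (caiChenLiMatrix_eq_zero v ?_ hπi hi)
      intro h
      exact hij (π.injective (h.trans h1.symm))
  · rfl

/-- **Cai–Chen–Li 2010, Lemma 2.5** (p. 44, PDF p008:L9–L17), verbatim: «Let `H(Mⁿ_v) = (H_{ij,kl})`.
Then for all `i, j : 1 ≤ i ≠ j ≤ n` and `k, l : 1 ≤ k ≠ l ≤ n`, we have `H_{ij,kl} ≡ v+n−2` if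
`k = j` and `l = i`; `1` if `k = j` and `l ≠ i, j`; `1` if `l = i` and `k ≠ i, j`; `0` otherwise.»
Here `H_{ij,kl} = ∂²per/∂x_{ij}∂x_{kl}` at `Mⁿ_v` = `hessianMatrix (perPoly (Fin (n+1)) F)
(caiChenLiMatrix F n v) (k,l) (i,j)` (variables indexed (row, column); the indices `1..n` of the
paper are the non-last elements of `Fin (n+1)`; «`≡`» = equality in `F` of characteristic `p`,
here any field). PROVED from the sub-permanent formula `hess0_transl_perPoly` and the support
counts above. [cite: CaiChenLi2010, Lemma 2.5, p. 44] -/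
theorem caiChenLi2010_lemma_2_5 {n : ℕ} (v : F) {i j k l : Fin (n + 1)} (hij : i ≠ j) (hkl : k ≠ l)
    (hi : i ≠ Fin.last n) (hj : j ≠ Fin.last n) (hk : k ≠ Fin.last n) (hl : l ≠ Fin.last n) :
    hessianMatrix (perPoly (Fin (n + 1)) F) (caiChenLiMatrix F n v) (k, l) (i, j) =
      if k = j ∧ l = i then v + ((n - 2 : ℕ) : F)
      else if (k = j ∧ l ≠ i) ∨ (l = i ∧ k ≠ j) then 1 else 0 := by
  split_ifs with h1 h2
  · obtain ⟨rfl, rfl⟩ := h1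
    exact caiChenLi2010_lemma_2_5_transpose v hij hi hj
  · rcases h2 with ⟨rfl, hli⟩ | ⟨rfl, hkj⟩
    · exact caiChenLi2010_lemma_2_5_case2 v hij hli hkl.symm hi hj hl
    · exact caiChenLi2010_lemma_2_5_case3 v hij hkl hkj hi hj hk
  · push Not at h1 h2
    by_cases hki : k = i
    · subst hki
      exact caiChenLi2010_lemma_2_5_zero_a v hkl.symm
    · by_cases hlj : l = j
      · subst hlj
        exact caiChenLi2010_lemma_2_5_zero_b v
      · have hkj : k ≠ j := fun h => h1 h (h2.1 h)
        have hli : l ≠ i := fun h => hkj (h2.2 h)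
        exact caiChenLi2010_lemma_2_5_zero_c v hij hkl hki hkj hli hi hk

end HessianEntries

/-! ### The rank estimate (replacing §4): `rank H(Mⁿ_v) + 2(n+1) ≥ n² − n` via `R' = BᵀB − 4·1` -/

section RankEstimate

variable {F : Type u} [Field F]

/-- The rank of an arbitrary submatrix (rows and columns selected by any maps, repetitions
allowed) is at most the rank: `A.submatrix f g = P A Q` for selection matrices `P, Q` — the step
«`R_v` is a sub-matrix of `H(Mⁿ_v)`, so `rank H ≥ rank R_v`» of the printed §4 (p. 48, PDF
p012:L34–L36), exposed for the cell's BS26-A assembly. [cite: CaiChenLi2010, §4 (the sub-matrix `R_v`), p. 48] -/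
theorem rank_submatrix_le_rank {m₀ n₀ m₁ n₁ : Type*} [Fintype m₀] [Fintype n₀]
    [Fintype m₁] [Fintype n₁] [DecidableEq m₀] [DecidableEq n₀] (A : Matrix m₀ n₀ F)
    (f : m₁ → m₀) (g : n₁ → n₀) : (A.submatrix f g).rank ≤ A.rank := by
  have h1 : A.submatrix f g =
      (1 : Matrix m₀ m₀ F).submatrix f id * A * (1 : Matrix n₀ n₀ F).submatrix id g := by
    ext i j
    simp [Matrix.mul_apply, Matrix.one_apply]
  rw [h1]
  exact (Matrix.rank_mul_le_left _ _).trans (Matrix.rank_mul_le_right _ _)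

/-- **Kernel trick**: for any matrix `B : W × S` over a field and `c ≠ 0`,
`|S| ≤ rank(BᵀB − c·1) + |W|`, because `BᵀB − c·1` acts as `−c` on `ker B`, a space of dimension
`≥ |S| − |W|`. [folklore] -/
private theorem card_le_rank_transpose_mul_self_sub_smul {W S : Type*} [Fintype W] [Fintype S]
    [DecidableEq W] [DecidableEq S] (B : Matrix W S F) {c : F} (hc : c ≠ 0) :
    Fintype.card S ≤ (Bᵀ * B - c • (1 : Matrix S S F)).rank + Fintype.card W := by
  set T : Matrix S S F := Bᵀ * B - c • (1 : Matrix S S F) with hT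
  set K := LinearMap.ker B.mulVecLin with hK
  have hTK : ∀ x ∈ K, T.mulVecLin x = -c • x := by
    intro x hx
    have hx' : B *ᵥ x = 0 := by simpa [hK, Matrix.mulVecLin_apply] using hx
    rw [Matrix.mulVecLin_apply, hT, Matrix.sub_mulVec, ← Matrix.mulVec_mulVec, hx',
      Matrix.mulVec_zero, Matrix.smul_mulVec, Matrix.one_mulVec, zero_sub, neg_smul]
  have hmap : Submodule.map T.mulVecLin K = K := by
    apply le_antisymm
    · rintro _ ⟨x, hx, rfl⟩
      rw [hTK x hx]
      exact K.smul_mem _ hx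
    · intro y hy
      refine ⟨(-c)⁻¹ • y, K.smul_mem _ hy, ?_⟩
      rw [map_smul, hTK y hy, smul_smul, inv_mul_cancel₀ (neg_ne_zero.mpr hc), one_smul]
  have h1 : Module.finrank F K ≤ T.rank := by
    have := Submodule.finrank_mono (LinearMap.map_le_range (f := T.mulVecLin) (p := K))
    rw [hmap] at this
    exact this
  have h2 : Module.finrank F (LinearMap.range B.mulVecLin) + Module.finrank F K =
      Fintype.card S := by
    rw [hK, LinearMap.finrank_range_add_finrank_ker, Module.finrank_fintype_fun_eq_card]
  have h3 : Module.finrank F (LinearMap.range B.mulVecLin) ≤ Fintype.card W :=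
    Matrix.rank_le_card_height B
  omega

variable (n : ℕ)

/-- The off-diagonal index set `S = {(i,j) : 1 ≤ i ≠ j ≤ n}` of the paper (§4, p. 48, PDF
p012:L34), as ordered pairs of distinct non-last indices of `Fin (n+1)` (plumbing for the rank
estimate). [cite: CaiChenLi2010, §4 (the set `S`), p. 48] -/
private def cclS : Finset (Fin (n + 1) × Fin (n + 1)) := (Finset.univ.erase (Fin.last n)).offDiag

/-- `|S| = n² − n` (§4, p. 48: «`R_v` is an `(n²−n) × (n²−n)` matrix»).
[cite: CaiChenLi2010, §4, p. 48] -/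
private theorem card_cclS : (cclS n).card = n * n - n := by
  rw [cclS, Finset.offDiag_card, Finset.card_erase_of_mem (Finset.mem_univ _), Finset.card_univ,
    Fintype.card_fin, Nat.add_sub_cancel]

/-- Membership in `S`: both indices non-last and distinct. [cite: CaiChenLi2010, §4 (the set `S`), p. 48] -/
private theorem mem_cclS {e : Fin (n + 1) × Fin (n + 1)} :
    e ∈ cclS n ↔ e.1 ≠ Fin.last n ∧ e.2 ≠ Fin.last n ∧ e.1 ≠ e.2 := by
  simp [cclS, Finset.mem_offDiag]

variable {n}

/-- The vertex–pair incidence matrix of the pairs in `S` (rows: row-vertices `inl r` and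
column-vertices `inr c`; entry `1` iff the pair uses that row / column index) — proof plumbing for
the kernel argument, not an object of the paper. [folklore] -/
private def cclB (F : Type u) [Field F] (n : ℕ) :
    Matrix (Fin (n + 1) ⊕ Fin (n + 1)) (cclS n) F :=
  Matrix.of fun w e => Sum.elim (fun r => if e.1.1 = r then (1 : F) else 0)
    (fun c => if e.1.2 = c then (1 : F) else 0) w

/-- Row-vertex entries of the incidence matrix. [folklore] -/
private theorem cclB_inl (r : Fin (n + 1)) (e : cclS n) :
    cclB F n (Sum.inl r) e = if e.1.1 = r then 1 else 0 := rfl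

/-- Column-vertex entries of the incidence matrix. [folklore] -/
private theorem cclB_inr (c : Fin (n + 1)) (e : cclS n) :
    cclB F n (Sum.inr c) e = if e.1.2 = c then 1 else 0 := rfl

/-- `(BᵀB)_{(ij),(kl)} = [i = k] + [j = l]` (number of shared indices; off the diagonal this is the
adjacency matrix of the line graph of the pairs). [folklore] -/
private theorem cclB_transpose_mul_self (e e' : cclS n) :
    ((cclB F n)ᵀ * cclB F n) e e' =
      (if e.1.1 = e'.1.1 then (1 : F) else 0) + (if e.1.2 = e'.1.2 then 1 else 0) := by
  rw [Matrix.mul_apply, Fintype.sum_sum_type]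
  simp only [Matrix.transpose_apply, cclB_inl, cclB_inr]
  have h1 : ∑ x : Fin (n + 1), (if e.1.1 = x then (1 : F) else 0) * (if e'.1.1 = x then 1 else 0)
      = if e.1.1 = e'.1.1 then 1 else 0 := by
    rw [Finset.sum_eq_single_of_mem e.1.1 (Finset.mem_univ _)]
    · by_cases h : e.1.1 = e'.1.1
      · simp [h]
      · simp [h, Ne.symm h]
    · intro x _ hx
      simp [Ne.symm hx]
  have h2 : ∑ x : Fin (n + 1), (if e.1.2 = x then (1 : F) else 0) * (if e'.1.2 = x then 1 else 0)
      = if e.1.2 = e'.1.2 then 1 else 0 := by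
    rw [Finset.sum_eq_single_of_mem e.1.2 (Finset.mem_univ _)]
    · by_cases h : e.1.2 = e'.1.2
      · simp [h]
      · simp [h, Ne.symm h]
    · intro x _ hx
      simp [Ne.symm hx]
  rw [h1, h2]

/-- The column-twisted restriction `R'_{(ij),(kl)} = H_{ij,lk}` of the Hessian at `Mⁿ_v` to
`S × S` as a matrix identity: `R' = (v + n − 4)·1 + BᵀB` (Lemma 2.5, rearranged).
[cite: CaiChenLi2010, Lemma 2.5 / §4, pp. 44, 48] -/
private theorem cclR_eq (v : F) :
    (Matrix.of fun e e' : cclS n =>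
      hessianMatrix (perPoly (Fin (n + 1)) F) (caiChenLiMatrix F n v) (e'.1.2, e'.1.1) e.1) =
      (v + ((n - 2 : ℕ) : F) - 2) • (1 : Matrix (cclS n) (cclS n) F) + (cclB F n)ᵀ * cclB F n := by
  ext e e'
  obtain ⟨hi, hj, hij⟩ := (mem_cclS n).mp e.2
  obtain ⟨hk, hl, hkl⟩ := (mem_cclS n).mp e'.2
  rw [Matrix.of_apply, Matrix.add_apply, cclB_transpose_mul_self, Matrix.smul_apply,
    show e.1 = (e.1.1, e.1.2) from rfl,
    caiChenLi2010_lemma_2_5 v hij (Ne.symm hkl) hi hj hl hk]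
  by_cases h1 : e.1.1 = e'.1.1
  · by_cases h2 : e.1.2 = e'.1.2
    · have hee : e = e' := Subtype.ext (Prod.ext h1 h2)
      subst hee
      simp [Matrix.one_apply_eq]
      ring
    · have hne : e ≠ e' := fun h => h2 (by rw [h])
      rw [Matrix.one_apply_ne hne]
      simp [h1, h2, Ne.symm h2]
  · by_cases h2 : e.1.2 = e'.1.2
    · have hne : e ≠ e' := fun h => h1 (by rw [h])
      rw [Matrix.one_apply_ne hne]
      simp [h1, h2, Ne.symm h1]
    · have hne : e ≠ e' := fun h => h1 (by rw [h])
      rw [Matrix.one_apply_ne hne]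
      simp [h1, h2, Ne.symm h1, Ne.symm h2]

/-- **Hessian rank of `per` at `Mⁿ_v` in characteristic `p ∣ n + v`, `p` odd**:
`n² − n ≤ rank H(Mⁿ_v) + 2(n+1)` — whence `rank H(Mⁿ_v) ≥ (n−2)(n−3)` for EVERY odd prime `p`
(the printed §4 argument needs `p ≠ 23`, resp. `p ∉ {3,5}`). Route (not the printed one): with
`P` the index transposition on `S`, Lemma 2.5 reads `R·P = (v+n−2)·1 + A`, `A = BᵀB − 2·1` the
adjacency matrix of the line graph of the pairs in `S` (`B` the incidence matrix); as
`v + n ≡ 0`, `R·P ≡ BᵀB − 4·1`, which acts as `−4 ≠ 0` on `ker B`, of dimension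
`≥ |S| − 2(n+1)`; and `rank H ≥ rank R = rank (R·P)`.
[cite: CaiChenLi2010, Thm. 2.3 / §4, pp. 43, 48–53] -/
theorem rank_hessianMatrix_perPoly_caiChenLiMatrix (p : ℕ) [Fact p.Prime] [CharP F p]
    (hp : p ≠ 2) {n v : ℕ} (hn : 2 ≤ n) (hdvd : p ∣ n + v) :
    n * n - n ≤ (hessianMatrix (perPoly (Fin (n + 1)) F) (caiChenLiMatrix F n (v : F))).rank
      + 2 * (n + 1) := by
  classical
  have h4 : (4 : F) ≠ 0 := by
    have h2 : (2 : F) ≠ 0 := by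
      intro h
      have h' : (p : ℕ) ∣ 2 := by
        rw [← CharP.cast_eq_zero_iff F p 2]
        exact_mod_cast h
      have hp2 : p ≤ 2 := Nat.le_of_dvd (by norm_num) h'
      have := (Fact.out : p.Prime).two_le
      omega
    have h44 : (4 : F) = 2 * 2 := by norm_num
    rw [h44]
    exact mul_ne_zero h2 h2
  have hcoef : ((v : F) + ((n - 2 : ℕ) : F) - 2) = -4 := by
    have hnv : ((n + v : ℕ) : F) = 0 := (CharP.cast_eq_zero_iff F p (n + v)).mpr hdvd
    have hn2 : ((n - 2 : ℕ) : F) = (n : F) - 2 := by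
      rw [Nat.cast_sub hn]
      norm_num
    rw [hn2]
    push_cast at hnv
    linear_combination hnv
  have hrank : (Matrix.of fun e e' : cclS n =>
      hessianMatrix (perPoly (Fin (n + 1)) F) (caiChenLiMatrix F n (v : F)) (e'.1.2, e'.1.1) e.1).rank
      ≤ (hessianMatrix (perPoly (Fin (n + 1)) F) (caiChenLiMatrix F n (v : F))).rank := by
    have hsub : (Matrix.of fun e e' : cclS n =>
        hessianMatrix (perPoly (Fin (n + 1)) F) (caiChenLiMatrix F n (v : F)) (e'.1.2, e'.1.1) e.1)
        = ((hessianMatrix (perPoly (Fin (n + 1)) F) (caiChenLiMatrix F n (v : F))).submatrix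
            (fun e' : cclS n => ((e'.1.2, e'.1.1) : Fin (n + 1) × Fin (n + 1)))
            (fun e : cclS n => e.1))ᵀ := by
      ext e e'
      rfl
    rw [hsub, Matrix.rank_transpose]
    exact rank_submatrix_le_rank _ _ _
  rw [cclR_eq (v : F), hcoef] at hrank
  have hker := card_le_rank_transpose_mul_self_sub_smul (cclB F n) h4
  have hre : (cclB F n)ᵀ * cclB F n - (4 : F) • (1 : Matrix (cclS n) (cclS n) F) =
      (-4 : F) • (1 : Matrix (cclS n) (cclS n) F) + (cclB F n)ᵀ * cclB F n := by
    rw [neg_smul, sub_eq_neg_add]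
  rw [hre] at hker
  have hcardS : Fintype.card (cclS n) = n * n - n := by
    rw [Fintype.card_coe, card_cclS]
  have hcardW : Fintype.card (Fin (n + 1) ⊕ Fin (n + 1)) = 2 * (n + 1) := by
    rw [Fintype.card_sum, Fintype.card_fin]
    ring
  rw [hcardS, hcardW] at hker
  omega

/-- **Discharge of `caiChenLi2010_thm_2_3`** (Cai–Chen–Li 2010, Thm. 2.3): the witness is
`X₀ = Mⁿ_v` (`caiChenLiMatrix`, `v = 1` in case (i), `v = 2` in case (ii)); `per(X₀) = n + v = 0`
(`eval_caiChenLiMatrix_perPoly_eq_zero`) and `rank H(X₀) ≥ n² − 3n − 2 ≥ (n−2)(n−3)` for `n ≥ 4`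
(`rank_hessianMatrix_perPoly_caiChenLiMatrix`; `(n−2)(n−3) = 0` for `n ≤ 3`). The exclusions
`p ≠ 23` / `p ∉ {3,5}` of the printed statement are not needed on this route.
[cite: CaiChenLi2010, Thm. 2.3, p. 43] -/
theorem caiChenLi2010_thm_2_3_holds : caiChenLi2010_thm_2_3.{u} := by
  intro p _ F _ _ hp
  have main : ∀ (v n : ℕ), 2 ≤ n → p ∣ n + v →
      ∃ X₀ : Fin (n + 1) × Fin (n + 1) → F, eval X₀ (perPoly (Fin (n + 1)) F) = 0 ∧
        (n - 2) * (n - 3) ≤ (hessianMatrix (perPoly (Fin (n + 1)) F) X₀).rank := by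
    intro v n hn hdvd
    refine ⟨caiChenLiMatrix F n (v : F), eval_caiChenLiMatrix_perPoly_eq_zero p hdvd, ?_⟩
    have h := rank_hessianMatrix_perPoly_caiChenLiMatrix (F := F) p hp hn hdvd
    rcases Nat.lt_or_ge n 4 with hlt | hge
    · have h0 : (n - 2) * (n - 3) = 0 := by
        interval_cases n <;> rfl
      rw [h0]
      exact Nat.zero_le _
    · obtain ⟨m, rfl⟩ : ∃ m, n = m + 4 := ⟨n - 4, by omega⟩
      have e1 : m + 4 - 2 = m + 2 := by omega
      have e2 : m + 4 - 3 = m + 1 := by omega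
      have e3 : (m + 4) * (m + 4) - (m + 4) = (m + 4) * (m + 3) := by
        have : (m + 4) * (m + 4) = (m + 4) * (m + 3) + (m + 4) := by ring
        omega
      rw [e1, e2]
      rw [e3] at h
      nlinarith [h]
  refine ⟨fun _ n hn hdvd => main 1 n (by omega) hdvd,
    fun _ _ n hn hdvd => main 2 n (by omega) hdvd⟩

end RankEstimate

/-! ### Unconditional forms (the fact being discharged) and Lemma 3.1 -/

section Unconditional

/-- **Cai–Chen–Li 2010, Lemma 3.1** (p. 45, PDF p009:L44–L46: «Let `p > 2` be a prime, then for
any sufficiently large `n` satisfying `p ∣ (n+1)`, we have `per(Mⁿ_1) ≡ 0 (mod p)` and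
`rank(H(Mⁿ_1)) = Ω(n²)`»), with the `Ω` made explicit as `n² ≤ 2·rank H(Mⁿ_1)` for `n ≥ 7`.
PROVED (from `eval_caiChenLiMatrix_perPoly_eq_zero` and `rank_hessianMatrix_perPoly_caiChenLiMatrix`:
`rank ≥ n² − 3n − 2 ≥ n²/2` for `n ≥ 7`). [cite: CaiChenLi2010, Lemma 3.1, p. 45] -/
theorem caiChenLi2010_lemma_3_1 (F : Type u) [Field F] (p : ℕ) [Fact p.Prime] [CharP F p]
    (hp : p ≠ 2) {n : ℕ} (hn : 7 ≤ n) (hdvd : p ∣ n + 1) :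
    eval (caiChenLiMatrix F n 1) (perPoly (Fin (n + 1)) F) = 0 ∧
      n * n ≤ 2 * (hessianMatrix (perPoly (Fin (n + 1)) F) (caiChenLiMatrix F n 1)).rank := by
  have h0 := eval_caiChenLiMatrix_perPoly_eq_zero (F := F) p (n := n) (v := 1) hdvd
  have h1 := rank_hessianMatrix_perPoly_caiChenLiMatrix (F := F) p hp (v := 1) (by omega) hdvd
  rw [Nat.cast_one] at h0 h1
  refine ⟨h0, ?_⟩
  have h2 : 6 * n + 4 ≤ n * n := by nlinarith
  omega

/-- **Theorem 2.3 ⇒ determinantal bounds, unconditionally** (the fact is discharged):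
over a field of odd characteristic `p`, (i) `p ≠ 23`, `n > 2`, `p ∣ n+1` ⇒
`(n−2)(n−3) ≤ 2·dc(per_{n+1})`; (ii) `p ∉ {3,5}`, `n > 1`, `p ∣ n+2` ⇒ the same.
[cite: CaiChenLi2010, Thm. 2.3 and §2.1, pp. 42–43] -/
theorem caiChenLi2010_dc_bound (p : ℕ) [Fact p.Prime] (F : Type u) [Field F] [CharP F p]
    (hp : p ≠ 2) :
    (p ≠ 23 → ∀ n : ℕ, 2 < n → p ∣ n + 1 →
      (n - 2) * (n - 3) ≤ 2 * determinantalComplexity (perPoly (Fin (n + 1)) F)) ∧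
    (p ≠ 3 → p ≠ 5 → ∀ n : ℕ, 1 < n → p ∣ n + 2 →
      (n - 2) * (n - 3) ≤ 2 * determinantalComplexity (perPoly (Fin (n + 1)) F)) :=
  caiChenLi2010_dc_of_thm_2_3 caiChenLi2010_thm_2_3_holds p F hp

/-- **Cai–Chen–Li 2010, Corollary 2.4, unconditionally** (in the form the printed proof gives):
for every odd prime `p`, every field of characteristic `p` and every `N` there is `n ≥ N` with
`(n−2)(n−3) ≤ 2·dc(per_{n+1})`. [cite: CaiChenLi2010, Cor. 2.4, p. 43] -/
theorem caiChenLi2010_cor_2_4_uncond (p : ℕ) [Fact p.Prime] (F : Type u) [Field F] [CharP F p]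
    (hp : p ≠ 2) (N : ℕ) :
    ∃ n : ℕ, N ≤ n ∧ (n - 2) * (n - 3) ≤ 2 * determinantalComplexity (perPoly (Fin (n + 1)) F) :=
  caiChenLi2010_cor_2_4 caiChenLi2010_thm_2_3_holds p F hp N

/-- **The quadratic lower bound for `dc(per_n)` in every odd characteristic, unconditionally**:
over a field of odd characteristic `p`, for every `n ≥ p + 3`, `(n−p−2)(n−p−3) ≤ 2·dc(per_n)` —
the content of the paper's title, now a theorem of the tree.
[cite: CaiChenLi2010, Thm. 2.3 and Cor. 2.4 (consequence), p. 43] -/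
theorem caiChenLi2010_quadratic_lower_bound (p : ℕ) [Fact p.Prime] (F : Type u) [Field F]
    [CharP F p] (hp : p ≠ 2) {n : ℕ} (hn : p + 3 ≤ n) :
    (n - p - 2) * (n - p - 3) ≤ 2 * determinantalComplexity (perPoly (Fin n) F) :=
  caiChenLi2010_eventually caiChenLi2010_thm_2_3_holds p F hp hn

end Unconditional

/-! ### Hessian entries of `per` at `Mⁿ_v` through the last index (BS26-A part B) -/

section HessianEntriesLast

variable {F : Type u} [Field F]

/-- Only the identity fixes a set `Dfix ∋ last` and is supported on the pattern of `Mⁿ_v` outside a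
set `E ⊇ Dfix` with at most one further index: `Σ_{σ fixing Dfix} ∏_{t ∉ E} M_{σ t, t} = 1`.
[cite: CaiChenLi2010, Lemma 2.5 (proof pattern), p. 44] -/
private theorem sum_perm_fix_last_prod_caiChenLiMatrix {n : ℕ} (v : F)
    (Dfix E : Finset (Fin (n + 1))) (hlast : Fin.last n ∈ Dfix) (hDE : Dfix ⊆ E)
    (hE : (E \ Dfix).card ≤ 1) :
    ∑ σ ∈ (Finset.univ : Finset (Equiv.Perm (Fin (n + 1)))).filter (fun σ => ∀ d ∈ Dfix, σ d = d),
      ∏ t ∈ Finset.univ \ E, caiChenLiMatrix F n v (σ t, t) = 1 := by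
  classical
  have h1 : (1 : Equiv.Perm (Fin (n + 1))) ∈
      (Finset.univ : Finset (Equiv.Perm (Fin (n + 1)))).filter (fun σ => ∀ d ∈ Dfix, σ d = d) := by
    simp
  rw [Finset.sum_eq_single_of_mem _ h1]
  · refine Finset.prod_eq_one fun t ht => ?_
    rw [Equiv.Perm.one_apply]
    exact caiChenLiMatrix_diag v (fun h => (Finset.mem_sdiff.mp ht).2 (hDE (h ▸ hlast)))
  · intro σ hσ hne
    have hfix : ∀ d ∈ Dfix, σ d = d := by simpa using hσ
    have hσl : σ (Fin.last n) = Fin.last n := hfix _ hlast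
    -- a vanishing factor, or else `σ` moves at most the points of `E \ Dfix` (≤ 1 point) ⇒ `σ = 1`
    by_contra hprod
    have H : ∀ t, t ∉ E → σ t = t := by
      intro t ht
      by_contra hσt
      have htl : t ≠ Fin.last n := fun h => ht (hDE (h ▸ hlast))
      have hσtl : σ t ≠ Fin.last n := fun h => htl (σ.injective (h.trans hσl.symm))
      exact hprod (Finset.prod_eq_zero (Finset.mem_sdiff.mpr ⟨Finset.mem_univ _, ht⟩)
        (caiChenLiMatrix_eq_zero v hσt hσtl htl))
    apply hne
    refine Equiv.ext fun u => ?_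
    rw [Equiv.Perm.one_apply]
    by_contra hu
    -- `u` and `σ u` are two distinct moved points, both in `E \ Dfix`
    have hmem : ∀ w, σ w ≠ w → w ∈ E \ Dfix := by
      intro w hw
      refine Finset.mem_sdiff.mpr ⟨?_, fun hD => hw (hfix w hD)⟩
      by_contra hwE
      exact hw (H w hwE)
    have hσu : σ (σ u) ≠ σ u := fun h => hu (σ.injective h)
    have h2 : ({u, σ u} : Finset (Fin (n + 1))) ⊆ E \ Dfix := by
      intro w hw
      rcases Finset.mem_insert.mp hw with rfl | hw
      · exact hmem _ hu
      · rw [Finset.mem_singleton.mp hw]; exact hmem _ hσu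
    have hcard := (Finset.card_le_card h2).trans hE
    rw [Finset.card_pair (Ne.symm hu)] at hcard
    omega

/-- `H_{★a,a★}(Mⁿ_v) = 1` (`★` = the last index, `a ≠ ★`): the transposed pair through the border.
[cite: CaiChenLi2010, Lemma 2.5 (proof pattern), p. 44] -/
theorem hessianMatrix_caiChenLiMatrix_lastA_aLast {n : ℕ} (v : F) {a : Fin (n + 1)}
    (ha : a ≠ Fin.last n) :
    hessianMatrix (perPoly (Fin (n + 1)) F) (caiChenLiMatrix F n v) (a, Fin.last n) (Fin.last n, a)
      = 1 := by
  classical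
  rw [hessianMatrix_apply, ← hess0_transl, hess0_transl_perPoly]
  -- conditions `π a = ★ ∧ ★ ≠ a ∧ π ★ = a`; reindex `π = σ * swap a ★`
  rw [← Equiv.sum_comp (Equiv.mulRight (Equiv.swap a (Fin.last n)))]
  simp only [Equiv.coe_mulRight, Equiv.Perm.mul_apply, Equiv.swap_apply_left,
    Equiv.swap_apply_right]
  have key := sum_perm_fix_last_prod_caiChenLiMatrix (F := F) v {a, Fin.last n} {a, Fin.last n}
    (by simp) (le_refl _) (by simp)
  rw [Finset.sum_filter] at key
  rw [← key]
  refine Finset.sum_congr rfl fun σ _ => ?_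
  have hE : (Finset.univ.erase a).erase (Fin.last n) =
      Finset.univ \ ({a, Fin.last n} : Finset (Fin (n + 1))) := by
    ext t
    simp [Finset.mem_erase, Finset.mem_sdiff]
    all_goals tauto
  have hcond : (σ (Fin.last n) = Fin.last n ∧ Fin.last n ≠ a ∧ σ a = a) ↔
      (∀ d ∈ ({a, Fin.last n} : Finset (Fin (n + 1))), σ d = d) := by
    simp only [Finset.mem_insert, Finset.mem_singleton, forall_eq_or_imp, forall_eq]
    exact ⟨fun h => ⟨h.2.2, h.1⟩, fun h => ⟨h.2, Ne.symm ha, h.1⟩⟩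
  by_cases hc : σ (Fin.last n) = Fin.last n ∧ Fin.last n ≠ a ∧ σ a = a
  · rw [if_pos hc, if_pos (hcond.mp hc), hE]
    refine Finset.prod_congr rfl fun t ht => ?_
    have ht' : t ≠ a ∧ t ≠ Fin.last n := by
      simpa [Finset.mem_sdiff, Finset.mem_insert, Finset.mem_singleton, not_or] using ht
    rw [Equiv.swap_apply_of_ne_of_ne ht'.1 ht'.2]
  · rw [if_neg hc, if_neg (fun h => hc (hcond.mpr h))]

/-- `H_{a★,★a}(Mⁿ_v) = 1`. [cite: CaiChenLi2010, Lemma 2.5 (proof pattern), p. 44] -/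
theorem hessianMatrix_caiChenLiMatrix_aLast_lastA {n : ℕ} (v : F) {a : Fin (n + 1)}
    (ha : a ≠ Fin.last n) :
    hessianMatrix (perPoly (Fin (n + 1)) F) (caiChenLiMatrix F n v) (Fin.last n, a) (a, Fin.last n)
      = 1 := by
  classical
  rw [hessianMatrix_apply, ← hess0_transl, hess0_transl_perPoly]
  -- conditions `π ★ = a ∧ a ≠ ★ ∧ π a = ★`; reindex `π = σ * swap a ★`
  rw [← Equiv.sum_comp (Equiv.mulRight (Equiv.swap a (Fin.last n)))]
  simp only [Equiv.coe_mulRight, Equiv.Perm.mul_apply, Equiv.swap_apply_left,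
    Equiv.swap_apply_right]
  have key := sum_perm_fix_last_prod_caiChenLiMatrix (F := F) v {a, Fin.last n} {a, Fin.last n}
    (by simp) (le_refl _) (by simp)
  rw [Finset.sum_filter] at key
  rw [← key]
  refine Finset.sum_congr rfl fun σ _ => ?_
  have hE : (Finset.univ.erase (Fin.last n)).erase a =
      Finset.univ \ ({a, Fin.last n} : Finset (Fin (n + 1))) := by
    ext t
    simp [Finset.mem_erase, Finset.mem_sdiff]
  have hcond : (σ a = a ∧ a ≠ Fin.last n ∧ σ (Fin.last n) = Fin.last n) ↔
      (∀ d ∈ ({a, Fin.last n} : Finset (Fin (n + 1))), σ d = d) := by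
    simp only [Finset.mem_insert, Finset.mem_singleton, forall_eq_or_imp, forall_eq]
    exact ⟨fun h => ⟨h.1, h.2.2⟩, fun h => ⟨h.1, ha, h.2⟩⟩
  by_cases hc : σ a = a ∧ a ≠ Fin.last n ∧ σ (Fin.last n) = Fin.last n
  · rw [if_pos hc, if_pos (hcond.mp hc), hE]
    refine Finset.prod_congr rfl fun t ht => ?_
    have ht' : t ≠ a ∧ t ≠ Fin.last n := by
      simpa [Finset.mem_sdiff, Finset.mem_insert, Finset.mem_singleton, not_or] using ht
    rw [Equiv.swap_apply_of_ne_of_ne ht'.1 ht'.2]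
  · rw [if_neg hc, if_neg (fun h => hc (hcond.mpr h))]

/-- `H_{★a,ab}(Mⁿ_v) = 1` (`a, b ≠ ★` distinct). [cite: CaiChenLi2010, Lemma 2.5 (proof pattern), p. 44] -/
theorem hessianMatrix_caiChenLiMatrix_lastA_aB {n : ℕ} (v : F) {a b : Fin (n + 1)}
    (ha : a ≠ Fin.last n) (hb : b ≠ Fin.last n) (hab : a ≠ b) :
    hessianMatrix (perPoly (Fin (n + 1)) F) (caiChenLiMatrix F n v) (a, b) (Fin.last n, a) = 1 := by
  classical
  rw [hessianMatrix_apply, ← hess0_transl, hess0_transl_perPoly]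
  -- conditions `π a = ★ ∧ b ≠ a ∧ π b = a`; `ρ = swap b a * swap a ★` : `a ↦ ★ ↦ b ↦ a`
  set ρ : Equiv.Perm (Fin (n + 1)) := Equiv.swap b a * Equiv.swap a (Fin.last n) with hρ
  have hρa : ρ a = Fin.last n := by
    rw [hρ, Equiv.Perm.mul_apply, Equiv.swap_apply_left,
      Equiv.swap_apply_of_ne_of_ne (Ne.symm hb) (Ne.symm ha)]
  have hρb : ρ b = a := by
    rw [hρ, Equiv.Perm.mul_apply, Equiv.swap_apply_of_ne_of_ne (Ne.symm hab) hb,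
      Equiv.swap_apply_left]
  have hρl : ρ (Fin.last n) = b := by
    rw [hρ, Equiv.Perm.mul_apply, Equiv.swap_apply_right, Equiv.swap_apply_right]
  have hρt : ∀ t, t ≠ a → t ≠ b → t ≠ Fin.last n → ρ t = t := by
    intro t h1 h2 h3
    rw [hρ, Equiv.Perm.mul_apply, Equiv.swap_apply_of_ne_of_ne h1 h3,
      Equiv.swap_apply_of_ne_of_ne h2 h1]
  rw [← Equiv.sum_comp (Equiv.mulRight ρ)]
  simp only [Equiv.coe_mulRight, Equiv.Perm.mul_apply, hρa, hρb]
  have key := sum_perm_fix_last_prod_caiChenLiMatrix (F := F) v {a, Fin.last n}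
    {b, a, Fin.last n} (by simp) (by intro x hx; simp at hx ⊢; tauto)
    (by
      have : ({b, a, Fin.last n} : Finset (Fin (n + 1))) \ {a, Fin.last n} ⊆ {b} := by
        intro x hx; simp at hx ⊢; tauto
      exact (Finset.card_le_card this).trans (by simp))
  rw [Finset.sum_filter] at key
  rw [← key]
  have hEl : Fin.last n ∈ (Finset.univ.erase a).erase b := by
    simp [Finset.mem_erase, Ne.symm ha, Ne.symm hb]
  have hErase : ((Finset.univ.erase a).erase b).erase (Fin.last n) =
      Finset.univ \ ({b, a, Fin.last n} : Finset (Fin (n + 1))) := by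
    ext t
    simp [Finset.mem_erase, Finset.mem_sdiff]
    all_goals tauto
  refine Finset.sum_congr rfl fun σ _ => ?_
  have hcond : (σ (Fin.last n) = Fin.last n ∧ b ≠ a ∧ σ a = a) ↔
      (∀ d ∈ ({a, Fin.last n} : Finset (Fin (n + 1))), σ d = d) := by
    simp only [Finset.mem_insert, Finset.mem_singleton, forall_eq_or_imp, forall_eq]
    exact ⟨fun h => ⟨h.2.2, h.1⟩, fun h => ⟨h.2, Ne.symm hab, h.1⟩⟩
  by_cases hc : σ (Fin.last n) = Fin.last n ∧ b ≠ a ∧ σ a = a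
  · rw [if_pos hc, if_pos (hcond.mp hc), ← Finset.mul_prod_erase _ _ hEl, hρl, hErase]
    have hσb : σ b ≠ Fin.last n := fun h => hb (σ.injective (h.trans hc.1.symm))
    rw [caiChenLiMatrix_col_last v hσb, one_mul]
    refine Finset.prod_congr rfl fun t ht => ?_
    have ht' : t ≠ b ∧ t ≠ a ∧ t ≠ Fin.last n := by
      simpa [Finset.mem_sdiff, Finset.mem_insert, Finset.mem_singleton, not_or] using ht
    rw [hρt t ht'.2.1 ht'.1 ht'.2.2]
  · rw [if_neg hc, if_neg (fun h => hc (hcond.mpr h))]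

/-- `H_{ab,★a}(Mⁿ_v) = 1` (`a, b ≠ ★` distinct). [cite: CaiChenLi2010, Lemma 2.5 (proof pattern), p. 44] -/
theorem hessianMatrix_caiChenLiMatrix_aB_lastA {n : ℕ} (v : F) {a b : Fin (n + 1)}
    (ha : a ≠ Fin.last n) (hb : b ≠ Fin.last n) (hab : a ≠ b) :
    hessianMatrix (perPoly (Fin (n + 1)) F) (caiChenLiMatrix F n v) (Fin.last n, a) (a, b) = 1 := by
  classical
  rw [hessianMatrix_apply, ← hess0_transl, hess0_transl_perPoly]
  -- conditions `π b = a ∧ a ≠ b ∧ π a = ★`; `ρ = swap (★) b * swap b a` : `b ↦ a ↦ ★ ↦ b`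
  set ρ : Equiv.Perm (Fin (n + 1)) := Equiv.swap (Fin.last n) b * Equiv.swap b a with hρ
  have hρb : ρ b = a := by
    rw [hρ, Equiv.Perm.mul_apply, Equiv.swap_apply_left,
      Equiv.swap_apply_of_ne_of_ne ha hab]
  have hρa : ρ a = Fin.last n := by
    rw [hρ, Equiv.Perm.mul_apply, Equiv.swap_apply_right, Equiv.swap_apply_right]
  have hρl : ρ (Fin.last n) = b := by
    rw [hρ, Equiv.Perm.mul_apply, Equiv.swap_apply_of_ne_of_ne (Ne.symm hb) (Ne.symm ha),
      Equiv.swap_apply_left]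
  have hρt : ∀ t, t ≠ a → t ≠ b → t ≠ Fin.last n → ρ t = t := by
    intro t h1 h2 h3
    rw [hρ, Equiv.Perm.mul_apply, Equiv.swap_apply_of_ne_of_ne h2 h1,
      Equiv.swap_apply_of_ne_of_ne h3 h2]
  rw [← Equiv.sum_comp (Equiv.mulRight ρ)]
  simp only [Equiv.coe_mulRight, Equiv.Perm.mul_apply, hρa, hρb]
  have key := sum_perm_fix_last_prod_caiChenLiMatrix (F := F) v {a, Fin.last n}
    {b, a, Fin.last n} (by simp) (by intro x hx; simp at hx ⊢; tauto)
    (by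
      have : ({b, a, Fin.last n} : Finset (Fin (n + 1))) \ {a, Fin.last n} ⊆ {b} := by
        intro x hx; simp at hx ⊢; tauto
      exact (Finset.card_le_card this).trans (by simp))
  rw [Finset.sum_filter] at key
  rw [← key]
  have hEl : Fin.last n ∈ (Finset.univ.erase b).erase a := by
    simp [Finset.mem_erase, Ne.symm ha, Ne.symm hb]
  have hErase : ((Finset.univ.erase b).erase a).erase (Fin.last n) =
      Finset.univ \ ({b, a, Fin.last n} : Finset (Fin (n + 1))) := by
    ext t
    simp [Finset.mem_erase, Finset.mem_sdiff]
    all_goals tauto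
  refine Finset.sum_congr rfl fun σ _ => ?_
  have hcond : (σ a = a ∧ a ≠ b ∧ σ (Fin.last n) = Fin.last n) ↔
      (∀ d ∈ ({a, Fin.last n} : Finset (Fin (n + 1))), σ d = d) := by
    simp only [Finset.mem_insert, Finset.mem_singleton, forall_eq_or_imp, forall_eq]
    exact ⟨fun h => ⟨h.1, h.2.2⟩, fun h => ⟨h.1, hab, h.2⟩⟩
  by_cases hc : σ a = a ∧ a ≠ b ∧ σ (Fin.last n) = Fin.last n
  · rw [if_pos hc, if_pos (hcond.mp hc), ← Finset.mul_prod_erase _ _ hEl, hρl, hErase]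
    have hσb : σ b ≠ Fin.last n := fun h => hb (σ.injective (h.trans hc.2.2.symm))
    rw [caiChenLiMatrix_col_last v hσb, one_mul]
    refine Finset.prod_congr rfl fun t ht => ?_
    have ht' : t ≠ b ∧ t ≠ a ∧ t ≠ Fin.last n := by
      simpa [Finset.mem_sdiff, Finset.mem_insert, Finset.mem_singleton, not_or] using ht
    rw [hρt t ht'.2.1 ht'.1 ht'.2.2]
  · rw [if_neg hc, if_neg (fun h => hc (hcond.mpr h))]

/-- `H_{a★,ba}(Mⁿ_v) = 1` (`a, b ≠ ★` distinct). [cite: CaiChenLi2010, Lemma 2.5 (proof pattern), p. 44] -/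
theorem hessianMatrix_caiChenLiMatrix_aLast_bA {n : ℕ} (v : F) {a b : Fin (n + 1)}
    (ha : a ≠ Fin.last n) (hb : b ≠ Fin.last n) (hab : a ≠ b) :
    hessianMatrix (perPoly (Fin (n + 1)) F) (caiChenLiMatrix F n v) (b, a) (a, Fin.last n) = 1 := by
  classical
  rw [hessianMatrix_apply, ← hess0_transl, hess0_transl_perPoly]
  -- conditions `π ★ = a ∧ a ≠ ★ ∧ π a = b`; `ρ = swap b ★ * swap ★ a` : `★ ↦ a ↦ b ↦ ★`
  set ρ : Equiv.Perm (Fin (n + 1)) := Equiv.swap b (Fin.last n) * Equiv.swap (Fin.last n) a with hρ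
  have hρl : ρ (Fin.last n) = a := by
    rw [hρ, Equiv.Perm.mul_apply, Equiv.swap_apply_left, Equiv.swap_apply_of_ne_of_ne hab ha]
  have hρa : ρ a = b := by
    rw [hρ, Equiv.Perm.mul_apply, Equiv.swap_apply_right, Equiv.swap_apply_right]
  have hρb : ρ b = Fin.last n := by
    rw [hρ, Equiv.Perm.mul_apply, Equiv.swap_apply_of_ne_of_ne hb (Ne.symm hab),
      Equiv.swap_apply_left]
  have hρt : ∀ t, t ≠ a → t ≠ b → t ≠ Fin.last n → ρ t = t := by
    intro t h1 h2 h3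
    rw [hρ, Equiv.Perm.mul_apply, Equiv.swap_apply_of_ne_of_ne h3 h1,
      Equiv.swap_apply_of_ne_of_ne h2 h3]
  rw [← Equiv.sum_comp (Equiv.mulRight ρ)]
  simp only [Equiv.coe_mulRight, Equiv.Perm.mul_apply, hρa, hρl]
  have key := sum_perm_fix_last_prod_caiChenLiMatrix (F := F) v {a, b, Fin.last n}
    {a, b, Fin.last n} (by simp) (le_refl _) (by simp)
  rw [Finset.sum_filter] at key
  rw [← key]
  have hEb : b ∈ (Finset.univ.erase (Fin.last n)).erase a := by
    simp [Finset.mem_erase, Ne.symm hab, hb]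
  have hErase : ((Finset.univ.erase (Fin.last n)).erase a).erase b =
      Finset.univ \ ({a, b, Fin.last n} : Finset (Fin (n + 1))) := by
    ext t
    simp [Finset.mem_erase, Finset.mem_sdiff]
    all_goals tauto
  refine Finset.sum_congr rfl fun σ _ => ?_
  by_cases hc : σ a = a ∧ a ≠ Fin.last n ∧ σ b = b
  · rw [if_pos hc, ← Finset.mul_prod_erase _ _ hEb, hρb, hErase,
      caiChenLiMatrix_apply_eq_ite v σ (Ne.symm hb) hc.2.2 hb]
    by_cases hσl : σ (Fin.last n) = Fin.last n
    · rw [if_pos hσl, one_mul, if_pos]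
      · refine Finset.prod_congr rfl fun t ht => ?_
        have ht' : t ≠ a ∧ t ≠ b ∧ t ≠ Fin.last n := by
          simpa [Finset.mem_sdiff, Finset.mem_insert, Finset.mem_singleton, not_or] using ht
        rw [hρt t ht'.1 ht'.2.1 ht'.2.2]
      · simp only [Finset.mem_insert, Finset.mem_singleton, forall_eq_or_imp, forall_eq]
        exact ⟨hc.1, hc.2.2, hσl⟩
    · rw [if_neg hσl, zero_mul, if_neg]
      intro h
      exact hσl (h _ (by simp))
  · rw [if_neg hc, if_neg]
    intro h
    simp only [Finset.mem_insert, Finset.mem_singleton, forall_eq_or_imp, forall_eq] at h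
    exact hc ⟨h.1, ha, h.2.1⟩

/-- `H_{ab,b★}(Mⁿ_v) = 1` (`a, b ≠ ★` distinct). [cite: CaiChenLi2010, Lemma 2.5 (proof pattern), p. 44] -/
theorem hessianMatrix_caiChenLiMatrix_aB_bLast {n : ℕ} (v : F) {a b : Fin (n + 1)}
    (ha : a ≠ Fin.last n) (hb : b ≠ Fin.last n) (hab : a ≠ b) :
    hessianMatrix (perPoly (Fin (n + 1)) F) (caiChenLiMatrix F n v) (b, Fin.last n) (a, b) = 1 := by
  classical
  rw [hessianMatrix_apply, ← hess0_transl, hess0_transl_perPoly]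
  -- conditions `π b = a ∧ ★ ≠ b ∧ π ★ = b`; `ρ = swap a ★ * swap ★ b` : `b ↦ a ↦ ★ ↦ b`
  set ρ : Equiv.Perm (Fin (n + 1)) := Equiv.swap a (Fin.last n) * Equiv.swap (Fin.last n) b with hρ
  have hρb : ρ b = a := by
    rw [hρ, Equiv.Perm.mul_apply, Equiv.swap_apply_right, Equiv.swap_apply_right]
  have hρl : ρ (Fin.last n) = b := by
    rw [hρ, Equiv.Perm.mul_apply, Equiv.swap_apply_left,
      Equiv.swap_apply_of_ne_of_ne (Ne.symm hab) hb]
  have hρa : ρ a = Fin.last n := by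
    rw [hρ, Equiv.Perm.mul_apply, Equiv.swap_apply_of_ne_of_ne ha hab, Equiv.swap_apply_left]
  have hρt : ∀ t, t ≠ a → t ≠ b → t ≠ Fin.last n → ρ t = t := by
    intro t h1 h2 h3
    rw [hρ, Equiv.Perm.mul_apply, Equiv.swap_apply_of_ne_of_ne h3 h2,
      Equiv.swap_apply_of_ne_of_ne h1 h3]
  rw [← Equiv.sum_comp (Equiv.mulRight ρ)]
  simp only [Equiv.coe_mulRight, Equiv.Perm.mul_apply, hρb, hρl]
  have key := sum_perm_fix_last_prod_caiChenLiMatrix (F := F) v {a, b, Fin.last n}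
    {a, b, Fin.last n} (by simp) (le_refl _) (by simp)
  rw [Finset.sum_filter] at key
  rw [← key]
  have hEa : a ∈ (Finset.univ.erase b).erase (Fin.last n) := by
    simp [Finset.mem_erase, hab, ha]
  have hErase : ((Finset.univ.erase b).erase (Fin.last n)).erase a =
      Finset.univ \ ({a, b, Fin.last n} : Finset (Fin (n + 1))) := by
    ext t
    simp [Finset.mem_erase, Finset.mem_sdiff]
    all_goals tauto
  refine Finset.sum_congr rfl fun σ _ => ?_
  by_cases hc : σ a = a ∧ Fin.last n ≠ b ∧ σ b = b
  · rw [if_pos hc, ← Finset.mul_prod_erase _ _ hEa, hρa, hErase,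
      caiChenLiMatrix_apply_eq_ite v σ (Ne.symm ha) hc.1 ha]
    by_cases hσl : σ (Fin.last n) = Fin.last n
    · rw [if_pos hσl, one_mul, if_pos]
      · refine Finset.prod_congr rfl fun t ht => ?_
        have ht' : t ≠ a ∧ t ≠ b ∧ t ≠ Fin.last n := by
          simpa [Finset.mem_sdiff, Finset.mem_insert, Finset.mem_singleton, not_or] using ht
        rw [hρt t ht'.1 ht'.2.1 ht'.2.2]
      · simp only [Finset.mem_insert, Finset.mem_singleton, forall_eq_or_imp, forall_eq]
        exact ⟨hc.1, hc.2.2, hσl⟩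
    · rw [if_neg hσl, zero_mul, if_neg]
      intro h
      exact hσl (h _ (by simp))
  · rw [if_neg hc, if_neg]
    intro h
    simp only [Finset.mem_insert, Finset.mem_singleton, forall_eq_or_imp, forall_eq] at h
    exact hc ⟨h.1, Ne.symm hb, h.2.1⟩

/-- The vanishing entries through the last index: `H_{★a,bc} = 0` for `b, c ∉ {a, ★}`.
[cite: CaiChenLi2010, Lemma 2.5 (proof pattern), p. 44] -/
theorem hessianMatrix_caiChenLiMatrix_lastA_bC {n : ℕ} (v : F) {a b c : Fin (n + 1)}
    (hb : b ≠ Fin.last n) (hba : b ≠ a) (hbc : b ≠ c) :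
    hessianMatrix (perPoly (Fin (n + 1)) F) (caiChenLiMatrix F n v) (b, c) (Fin.last n, a) = 0 := by
  classical
  rw [hessianMatrix_apply, ← hess0_transl, hess0_transl_perPoly]
  refine Finset.sum_eq_zero fun π _ => ?_
  split_ifs with h
  · obtain ⟨h1, _, h3⟩ := h
    have hbE : b ∈ (Finset.univ.erase a).erase c := by simp [Finset.mem_erase, hba, hbc]
    refine Finset.prod_eq_zero hbE (caiChenLiMatrix_eq_zero v ?_ ?_ hb)
    · intro h; exact hbc (π.injective (h.trans h3.symm))
    · intro h; exact hba (π.injective (h.trans h1.symm))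
  · rfl

/-- `H_{a★,bc} = 0` for `a ≠ ★`, `b, c ∉ {a, ★}` distinct. [cite: CaiChenLi2010, Lemma 2.5 (proof pattern), p. 44] -/
theorem hessianMatrix_caiChenLiMatrix_aLast_bC {n : ℕ} (v : F) {a b c : Fin (n + 1)}
    (ha : a ≠ Fin.last n) (hb : b ≠ Fin.last n) (hba : b ≠ a) (hca : c ≠ a) (hbc : b ≠ c) :
    hessianMatrix (perPoly (Fin (n + 1)) F) (caiChenLiMatrix F n v) (b, c) (a, Fin.last n) = 0 := by
  classical
  rw [hessianMatrix_apply, ← hess0_transl, hess0_transl_perPoly]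
  refine Finset.sum_eq_zero fun π _ => ?_
  split_ifs with h
  · obtain ⟨h1, _, h3⟩ := h
    by_cases hπa : π a = Fin.last n
    · have hbE : b ∈ (Finset.univ.erase (Fin.last n)).erase c := by
        simp [Finset.mem_erase, hb, hbc]
      refine Finset.prod_eq_zero hbE (caiChenLiMatrix_eq_zero v ?_ ?_ hb)
      · intro h; exact hbc (π.injective (h.trans h3.symm))
      · intro h; exact hba (π.injective (h.trans hπa.symm))
    · have haE : a ∈ (Finset.univ.erase (Fin.last n)).erase c := by
        simp [Finset.mem_erase, ha, Ne.symm hca]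
      refine Finset.prod_eq_zero haE (caiChenLiMatrix_eq_zero v ?_ hπa ha)
      intro h; exact ha (π.injective (h.trans h1.symm))
  · rfl

/-- `H_{ab,★c} = 0` for `a, b ≠ ★` distinct and `c ∉ {a, b}`. [cite: CaiChenLi2010, Lemma 2.5 (proof pattern), p. 44] -/
theorem hessianMatrix_caiChenLiMatrix_aB_lastC {n : ℕ} (v : F) {a b c : Fin (n + 1)}
    (ha : a ≠ Fin.last n) (hab : a ≠ b) (hca : c ≠ a) :
    hessianMatrix (perPoly (Fin (n + 1)) F) (caiChenLiMatrix F n v) (Fin.last n, c) (a, b) = 0 := by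
  classical
  rw [hessianMatrix_apply, ← hess0_transl, hess0_transl_perPoly]
  refine Finset.sum_eq_zero fun π _ => ?_
  split_ifs with h
  · obtain ⟨h1, _, h3⟩ := h
    have haE : a ∈ (Finset.univ.erase b).erase c := by simp [Finset.mem_erase, hab, Ne.symm hca]
    refine Finset.prod_eq_zero haE (caiChenLiMatrix_eq_zero v ?_ ?_ ha)
    · intro h; exact hab (π.injective (h.trans h1.symm))
    · intro h; exact hca (π.injective (h3.trans h.symm))
  · rfl

/-- `H_{ab,c★} = 0` for `a, b ≠ ★` distinct and `c ∉ {a, b, ★}`. [cite: CaiChenLi2010, Lemma 2.5 (proof pattern), p. 44] -/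
theorem hessianMatrix_caiChenLiMatrix_aB_cLast {n : ℕ} (v : F) {a b c : Fin (n + 1)}
    (ha : a ≠ Fin.last n) (hab : a ≠ b) (hca : c ≠ a) (hcb : c ≠ b) (hc : c ≠ Fin.last n) :
    hessianMatrix (perPoly (Fin (n + 1)) F) (caiChenLiMatrix F n v) (c, Fin.last n) (a, b) = 0 := by
  classical
  rw [hessianMatrix_apply, ← hess0_transl, hess0_transl_perPoly]
  refine Finset.sum_eq_zero fun π _ => ?_
  split_ifs with h
  · obtain ⟨h1, _, h3⟩ := h
    by_cases hπa : π a = Fin.last n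
    · have hcE : c ∈ (Finset.univ.erase b).erase (Fin.last n) := by
        simp [Finset.mem_erase, hcb, hc]
      refine Finset.prod_eq_zero hcE (caiChenLiMatrix_eq_zero v ?_ ?_ hc)
      · intro h; exact hc (π.injective (h.trans h3.symm))
      · intro h; exact hca (π.injective (h.trans hπa.symm))
    · have haE : a ∈ (Finset.univ.erase b).erase (Fin.last n) := by
        simp [Finset.mem_erase, hab, ha]
      refine Finset.prod_eq_zero haE (caiChenLiMatrix_eq_zero v ?_ hπa ha)
      intro h; exact hab (π.injective (h.trans h1.symm))
  · rfl

/-- `H_{★a,b★} = 0` for `b ∉ {a, ★}`. [cite: CaiChenLi2010, Lemma 2.5 (proof pattern), p. 44] -/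
theorem hessianMatrix_caiChenLiMatrix_lastA_bLast {n : ℕ} (v : F) {a b : Fin (n + 1)}
    (hb : b ≠ Fin.last n) (hba : b ≠ a) :
    hessianMatrix (perPoly (Fin (n + 1)) F) (caiChenLiMatrix F n v) (b, Fin.last n) (Fin.last n, a)
      = 0 := by
  classical
  rw [hessianMatrix_apply, ← hess0_transl, hess0_transl_perPoly]
  refine Finset.sum_eq_zero fun π _ => ?_
  split_ifs with h
  · obtain ⟨h1, _, h3⟩ := h
    have hbE : b ∈ (Finset.univ.erase a).erase (Fin.last n) := by simp [Finset.mem_erase, hba, hb]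
    refine Finset.prod_eq_zero hbE (caiChenLiMatrix_eq_zero v ?_ ?_ hb)
    · intro h; exact hb (π.injective (h.trans h3.symm))
    · intro h; exact hba (π.injective (h.trans h1.symm))
  · rfl

/-- `H_{a★,★b} = 0` for `a ≠ ★`, `b ∉ {a, ★}`. [cite: CaiChenLi2010, Lemma 2.5 (proof pattern), p. 44] -/
theorem hessianMatrix_caiChenLiMatrix_aLast_lastB {n : ℕ} (v : F) {a b : Fin (n + 1)}
    (ha : a ≠ Fin.last n) (hba : b ≠ a) :
    hessianMatrix (perPoly (Fin (n + 1)) F) (caiChenLiMatrix F n v) (Fin.last n, b) (a, Fin.last n)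
      = 0 := by
  classical
  rw [hessianMatrix_apply, ← hess0_transl, hess0_transl_perPoly]
  refine Finset.sum_eq_zero fun π _ => ?_
  split_ifs with h
  · obtain ⟨h1, _, h3⟩ := h
    have haE : a ∈ (Finset.univ.erase (Fin.last n)).erase b := by
      simp [Finset.mem_erase, ha, Ne.symm hba]
    refine Finset.prod_eq_zero haE (caiChenLiMatrix_eq_zero v ?_ ?_ ha)
    · intro h; exact ha (π.injective (h.trans h1.symm))
    · intro h; exact hba (π.injective (h3.trans h.symm))
  · rfl


/-- **All off-diagonal-pair Hessian entries of `per` at `Mⁿ_v`, one closed form** (Lemma 2.5 inside,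
the lemmas above through the last index `★`): for `i ≠ j`, `k ≠ l`,
`H_{ij,kl}(Mⁿ_v) = v + n − 2` if `(k,l) = (j,i)` with `i, j ≠ ★`; `= 1` if `(k,l) = (j,i)` through `★`,
or `k = j ≠ ★ ∧ l ≠ i`, or `l = i ≠ ★ ∧ k ≠ j`; `= 0` otherwise. (At `v = −n` this is the matrix
`bsR` of the BS26-A blueprint, lmr/BLUEPRINT-OddCharHessianBound.md §7, with `−2` on inner transposed
pairs.) [cite: CaiChenLi2010, Lemma 2.5 (and its proof pattern), p. 44] -/
theorem hessianMatrix_perPoly_caiChenLiMatrix_offDiag {n : ℕ} (v : F) {i j k l : Fin (n + 1)}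
    (hij : i ≠ j) (hkl : k ≠ l) :
    hessianMatrix (perPoly (Fin (n + 1)) F) (caiChenLiMatrix F n v) (k, l) (i, j) =
      if k = j ∧ l = i then (if i = Fin.last n ∨ j = Fin.last n then 1 else v + ((n - 2 : ℕ) : F))
      else if (k = j ∧ j ≠ Fin.last n ∧ l ≠ i) ∨ (l = i ∧ i ≠ Fin.last n ∧ k ≠ j) then 1
      else 0 := by
  by_cases hi : i = Fin.last n
  · subst hi
    have hj : j ≠ Fin.last n := Ne.symm hij
    by_cases hk : k = Fin.last n
    · subst hk
      rw [caiChenLi2010_lemma_2_5_zero_a v (Ne.symm hkl)]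
      simp [Ne.symm hj]
    · by_cases hl : l = Fin.last n
      · subst hl
        by_cases hkj : k = j
        · subst hkj
          rw [hessianMatrix_caiChenLiMatrix_lastA_aLast v hk]
          simp
        · rw [hessianMatrix_caiChenLiMatrix_lastA_bLast v hk hkj]
          simp [hkj]
      · by_cases hlj : l = j
        · subst hlj
          rw [caiChenLi2010_lemma_2_5_zero_b v]
          have hkj : k ≠ l := hkl
          simp [hkj, hl]
        · by_cases hkj : k = j
          · subst hkj
            rw [hessianMatrix_caiChenLiMatrix_lastA_aB v hk hl hkl]
            simp [hk, hl]
          · rw [hessianMatrix_caiChenLiMatrix_lastA_bC v hk hkj hkl]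
            simp [hkj, hl]
  · by_cases hj : j = Fin.last n
    · subst hj
      by_cases hl : l = Fin.last n
      · subst hl
        rw [caiChenLi2010_lemma_2_5_zero_b v]
        simp [hi, Ne.symm hi]
      · by_cases hk : k = Fin.last n
        · subst hk
          by_cases hli : l = i
          · subst hli
            rw [hessianMatrix_caiChenLiMatrix_aLast_lastA v hi]
            simp
          · rw [hessianMatrix_caiChenLiMatrix_aLast_lastB v hi hli]
            simp [hli]
        · by_cases hki : k = i
          · subst hki
            rw [caiChenLi2010_lemma_2_5_zero_a v (Ne.symm hkl)]
            have hli : l ≠ k := Ne.symm hkl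
            simp [hli, hk]
          · by_cases hli : l = i
            · subst hli
              rw [hessianMatrix_caiChenLiMatrix_aLast_bA v hi hk (Ne.symm hki)]
              simp [hi, hk]
            · rw [hessianMatrix_caiChenLiMatrix_aLast_bC v hi hk hki hli hkl]
              simp [hli, hk]
    · by_cases hk : k = Fin.last n
      · subst hk
        by_cases hlj : l = j
        · subst hlj
          rw [caiChenLi2010_lemma_2_5_zero_b v]
          simp [Ne.symm hj, Ne.symm hij]
        · by_cases hli : l = i
          · subst hli
            rw [hessianMatrix_caiChenLiMatrix_aB_lastA v hi hj hij]
            simp [hi, Ne.symm hj]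
          · rw [hessianMatrix_caiChenLiMatrix_aB_lastC v hi hij hli]
            simp [hli, Ne.symm hj]
      · by_cases hl : l = Fin.last n
        · subst hl
          by_cases hki : k = i
          · subst hki
            rw [caiChenLi2010_lemma_2_5_zero_a v (Ne.symm hi)]
            simp [hij, Ne.symm hi]
          · by_cases hkj : k = j
            · subst hkj
              rw [hessianMatrix_caiChenLiMatrix_aB_bLast v hi hj hij]
              simp [hj, Ne.symm hi]
            · rw [hessianMatrix_caiChenLiMatrix_aB_cLast v hi hij hki hkj hk]
              simp [hkj, Ne.symm hi]
        · rw [caiChenLi2010_lemma_2_5 v hij hkl hi hj hk hl]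
          simp [hi, hj]

end HessianEntriesLast

/-! ### Every field with `2 ≠ 0`: the witness at `v = −n` (interim, exclusion-free form) -/

section TwoNeZero

variable {F : Type u} [Field F]

/-- **Hessian rank of `per` at `Mⁿ_{−n}` over EVERY field with `2 ≠ 0`**:
`n² − n ≤ rank H(Mⁿ_{−n}) + 2(n+1)`. Same kernel argument as
`rank_hessianMatrix_perPoly_caiChenLiMatrix`, with the corner `v = −n` taken in the field (so
`v + n − 4 = −4` identically, no characteristic hypothesis): `R·P = BᵀB − 4·1` acts as `−4` on
`ker B`. The witness `Mⁿ_{−n}` is the «arrow matrix» `A_m` of Bedi–Suagee (cell blueprint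
`lmr/BLUEPRINT-OddCharHessianBound.md` §1/§7), whose full-rank analysis (their explicit inverse)
gives the sharper `m² − m`; this is the interim, inverse-free form.
[cite: CaiChenLi2010, Thm. 2.3 / §4 (witness and sub-matrix), pp. 43, 48]
[cite: BediSuagee2026, main theorem (weaker, inverse-free form)] -/
theorem rank_hessianMatrix_perPoly_caiChenLiMatrix_neg (h2 : (2 : F) ≠ 0) {n : ℕ} (hn : 2 ≤ n) :
    n * n - n ≤ (hessianMatrix (perPoly (Fin (n + 1)) F) (caiChenLiMatrix F n (-(n : F)))).rank
      + 2 * (n + 1) := by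
  classical
  have h4 : (4 : F) ≠ 0 := by
    have h44 : (4 : F) = 2 * 2 := by norm_num
    rw [h44]
    exact mul_ne_zero h2 h2
  have hcoef : (-(n : F) + ((n - 2 : ℕ) : F) - 2) = -4 := by
    rw [Nat.cast_sub hn]
    push_cast
    ring
  have hrank : (Matrix.of fun e e' : cclS n =>
      hessianMatrix (perPoly (Fin (n + 1)) F) (caiChenLiMatrix F n (-(n : F))) (e'.1.2, e'.1.1)
        e.1).rank
      ≤ (hessianMatrix (perPoly (Fin (n + 1)) F) (caiChenLiMatrix F n (-(n : F)))).rank := by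
    have hsub : (Matrix.of fun e e' : cclS n =>
        hessianMatrix (perPoly (Fin (n + 1)) F) (caiChenLiMatrix F n (-(n : F))) (e'.1.2, e'.1.1)
          e.1)
        = ((hessianMatrix (perPoly (Fin (n + 1)) F) (caiChenLiMatrix F n (-(n : F)))).submatrix
            (fun e' : cclS n => ((e'.1.2, e'.1.1) : Fin (n + 1) × Fin (n + 1)))
            (fun e : cclS n => e.1))ᵀ := by
      ext e e'
      rfl
    rw [hsub, Matrix.rank_transpose]
    exact rank_submatrix_le_rank _ _ _
  rw [cclR_eq (-(n : F)), hcoef] at hrank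
  have hker := card_le_rank_transpose_mul_self_sub_smul (cclB F n) h4
  have hre : (cclB F n)ᵀ * cclB F n - (4 : F) • (1 : Matrix (cclS n) (cclS n) F) =
      (-4 : F) • (1 : Matrix (cclS n) (cclS n) F) + (cclB F n)ᵀ * cclB F n := by
    rw [neg_smul, sub_eq_neg_add]
  rw [hre] at hker
  have hcardS : Fintype.card (cclS n) = n * n - n := by
    rw [Fintype.card_coe, card_cclS]
  have hcardW : Fintype.card (Fin (n + 1) ⊕ Fin (n + 1)) = 2 * (n + 1) := by
    rw [Fintype.card_sum, Fintype.card_fin]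
    ring
  rw [hcardS, hcardW] at hker
  omega

/-- **A quadratic lower bound for `dc(per_m)` over EVERY field with `2 ≠ 0`, all `m`** (interim,
exclusion-free and characteristic-free form): `m² ≤ 2·dc(per_m) + 5m`, i.e.
`dc(per_m) ≥ (m² − 5m)/2`. Proof: `per(Mⁿ_{−n}) = n + (−n) = 0` over any field
(`eval_caiChenLiMatrix_perPoly`), the rank estimate `rank_hessianMatrix_perPoly_caiChenLiMatrix_neg`,
and the tree's `rank H ≤ 2·dc` at a zero (`rank_hessianMatrix_le_two_mul_determinantalComplexity`),
with `m = n + 1`; `m ≤ 2` is trivial. The cell's BS26-A target (Bedi–Suagee: `m² − m ≤ 2·dc(per_m)`,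
via the explicit inverse of the off-diagonal block) sharpens this; Cai–Chen–Li's printed results
give it only in characteristic `p ∣ n + v` with their exclusions.
[cite: BediSuagee2026, main theorem (weaker form `m² − 5m` in place of `m² − m`)]
[cite: CaiChenLi2010, Thm. 2.3 / §2.1–§4 (method), pp. 41–48] -/
theorem sq_le_two_mul_determinantalComplexity_perPoly_add_of_two_ne_zero (F : Type u) [Field F]
    (h2 : (2 : F) ≠ 0) (m : ℕ) :
    m * m ≤ 2 * determinantalComplexity (perPoly (Fin m) F) + 5 * m := by
  rcases Nat.lt_or_ge m 3 with hlt | hge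
  · have : m * m ≤ 5 * m := by nlinarith
    omega
  · obtain ⟨n, rfl⟩ : ∃ n, m = n + 1 := ⟨m - 1, by omega⟩
    have hn : 2 ≤ n := by omega
    have hzero : eval (caiChenLiMatrix F n (-(n : F))) (perPoly (Fin (n + 1)) F) = 0 := by
      rw [eval_caiChenLiMatrix_perPoly]
      ring
    have hrk := rank_hessianMatrix_perPoly_caiChenLiMatrix_neg (F := F) h2 hn
    have hdc := rank_hessianMatrix_le_two_mul_determinantalComplexity
      (perPoly (Fin (n + 1)) F) _ hzero
    have hsq : n * n = (n * n - n) + n := by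
      have : n ≤ n * n := by nlinarith
      omega
    nlinarith [hrk, hdc, hsq]


/-- The rank-level form over every field with `2 ≠ 0` (the shape requested for the cell's V0
history line, lead-lmr 2026-08-26T07:57:40Z (i)): for `n ≥ 2`,
`n² − n ≤ 2·dc(per_{n+1}) + 2(n+1)`, i.e. `dc(per_m) ≥ (m² − 5m + 2)/2` for `m = n + 1 ≥ 3`.
[cite: BediSuagee2026, main theorem (weaker, inverse-free form)]
[cite: CaiChenLi2010, Thm. 2.3 / §2.1–§4 (method), pp. 41–48] -/
theorem sq_sub_le_two_mul_determinantalComplexity_perPoly_add_of_two_ne_zero (F : Type u) [Field F]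
    (h2 : (2 : F) ≠ 0) {n : ℕ} (hn : 2 ≤ n) :
    n * n - n ≤ 2 * determinantalComplexity (perPoly (Fin (n + 1)) F) + 2 * (n + 1) := by
  have hzero : eval (caiChenLiMatrix F n (-(n : F))) (perPoly (Fin (n + 1)) F) = 0 := by
    rw [eval_caiChenLiMatrix_perPoly]
    ring
  have hrk := rank_hessianMatrix_perPoly_caiChenLiMatrix_neg (F := F) h2 hn
  have hdc := rank_hessianMatrix_le_two_mul_determinantalComplexity
    (perPoly (Fin (n + 1)) F) _ hzero
  omega

/-- **The `p`-uniform quadratic bound in every odd characteristic** (lead-lmr 07:57:40Z (i)): for a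
prime `p ≠ 2`, a field of characteristic `p` and `n ≥ 2`,
`n² − n ≤ 2·dc(per_{n+1}) + 2(n+1)` — no excluded prime and no `p`-shift (compare the printed,
`p`-dependent `caiChenLi2010_quadratic_lower_bound`). Immediate from the field-general form, as
`(2 : F) ≠ 0` in odd characteristic. [cite: CaiChenLi2010, Thm. 2.3 / Cor. 2.4 (uniform consequence), p. 43]
[cite: BediSuagee2026, main theorem (weaker, inverse-free form)] -/
theorem caiChenLi2010_quadratic_lower_bound_uniform (p : ℕ) [Fact p.Prime] (F : Type u) [Field F]
    [CharP F p] (hp : p ≠ 2) {n : ℕ} (hn : 2 ≤ n) :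
    n * n - n ≤ 2 * determinantalComplexity (perPoly (Fin (n + 1)) F) + 2 * (n + 1) := by
  have h2 : (2 : F) ≠ 0 := by
    intro h
    have h' : (p : ℕ) ∣ 2 := by
      rw [← CharP.cast_eq_zero_iff F p 2]
      exact_mod_cast h
    have hp2 : p ≤ 2 := Nat.le_of_dvd (by norm_num) h'
    have := (Fact.out : p.Prime).two_le
    omega
  exact sq_sub_le_two_mul_determinantalComplexity_perPoly_add_of_two_ne_zero F h2 hn

end TwoNeZero

end Literature.Computability.AlgebraicComplexity
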